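import Literature.Analysis.FluidPDE.AsymBurgersAngularSmallness
import Literature.Analysis.FluidPDE.PlanarCircleWirtinger
import Mathlib.Analysis.SpecialFunctions.JapaneseBracket
import Literature.NumberTheory.Sieve.JurkatRichertMajorants
import HarnessLib

/-!
# The even sector: `∫ (4/|x|² − Φ) ⟪v, x⟫² ≤ (5/4) ∫ |x|² (∂_θu)²`

Analysis/FluidPDE file (all results proved). Notation as in `AsymBurgersAngularSmallness`:
`v = K ∗ w`, `ψ = N ∗ w`, `Φ = kerWeight`, `u = w + Φψ`, `∂_θ = D(·)[x^⊥]`. The function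
`g = ⟪v, x⟫ = −∂_θψ` is `C²`, has zero circular means, is even when `w` is even, and satisfies
`Δg = −∂_θw` (from `Δv = (∇w)^⊥`, i.e. `div v = 0`, `curl v = w` differentiated once). It decays
like `1/|x|`, and when `∫ w = 0` moreover `∇g, ∂ᵢ∂ᵢg = O(1/|x|²)`, so that
`∫ |∇g|² = −∫ g Δg = ∫ g ∂_θw` with no boundary terms. Wirtinger's inequality in the even sector
(`4∫ g² dθ ≤ ∫ (∂_θg)² dθ` on every circle) and `∂_θw = ∂_θu + Φ g` then give the positivity
estimate of the title, which converts the smallness of `∂_θu` at large circulation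
(`AsymBurgersAngularSmallness`) into smallness of `∂_θw`
(`exists_integral_gaussWeightChi_omega_sq_angular_le`). This replaces the abstract
positivity/compactness step of Maekawa's proof (Maekawa 2009, §4, Prop. 4.3 and Lemma 4.1) by
an explicit inequality.

## References

* Y. Maekawa, *Existence of asymmetric Burgers vortices and their asymptotic behavior at large
  circulations*, Math. Models Methods Appl. Sci. 19 (2009), §4. [Maekawa2009b]
* Th. Gallay, Y. Maekawa, *Existence and stability of viscous vortices*, arXiv:1610.08384, §4.1.
  [GallayMaekawa2016]
-/

noncomputable section

open Set Function Filter MeasureTheory Metric Real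
open scoped InnerProductSpace RealInnerProductSpace Topology Laplacian

namespace Literature.Analysis.FluidPDE

/-! ### Kernel facts -/

/-- `⟪K(z), z⟫ = 0`. [folklore] -/
theorem inner_biotSavartKernel2D_self (z : EuclideanSpace ℝ (Fin 2)) : ⟪biotSavartKernel2D z, z⟫ = 0 := by
  rw [biotSavartKernel2D, inner_smul_left]
  simp

/-- `⟪K(x − y), x⟫ = ⟪K(x − y), y⟫`. [folklore] -/
theorem inner_biotSavartKernel2D_sub_left (x y : EuclideanSpace ℝ (Fin 2)) :
    ⟪biotSavartKernel2D (x - y), x⟫ = ⟪biotSavartKernel2D (x - y), y⟫ := by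
  have h := inner_biotSavartKernel2D_self (x - y)
  rw [inner_sub_right] at h
  linarith

/-- **The far-field cancellation of the Biot–Savart kernel**:
`‖K(x − y) − K(x)‖ ≤ 3|y|/|x|²` for `|x| ≥ 2|y|`, `x ≠ 0`. [folklore] -/
theorem norm_biotSavartKernel2D_sub_sub_le {x y : EuclideanSpace ℝ (Fin 2)} (hx : x ≠ 0)
    (hxy : 2 * ‖y‖ ≤ ‖x‖) :
    ‖biotSavartKernel2D (x - y) - biotSavartKernel2D x‖ ≤ 3 * ‖y‖ / ‖x‖ ^ 2 := by
  have hx0 : 0 < ‖x‖ := norm_pos_iff.2 hx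
  have hd : ‖x‖ / 2 ≤ ‖x - y‖ := by
    have := norm_sub_norm_le x y
    linarith
  have hd0 : 0 < ‖x - y‖ := by linarith
  set c₁ := (2 * π * ‖x - y‖ ^ 2)⁻¹ with hc₁
  set c₂ := (2 * π * ‖x‖ ^ 2)⁻¹ with hc₂
  have hc₁0 : 0 < c₁ := by positivity
  have hform : biotSavartKernel2D (x - y) - biotSavartKernel2D x = (c₁ - c₂) • perp x - c₁ • perp y := by
    simp only [biotSavartKernel2D, perp_sub, smul_sub, sub_smul, ← hc₁, ← hc₂]
    abel
  rw [hform]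
  have hn1 : ‖(c₁ - c₂) • perp x - c₁ • perp y‖ ≤ |c₁ - c₂| * ‖x‖ + c₁ * ‖y‖ := by
    refine (norm_sub_le _ _).trans ?_
    rw [norm_smul, norm_smul, norm_perp, norm_perp, Real.norm_eq_abs, Real.norm_eq_abs,
      abs_of_pos hc₁0]
  -- `c₁ ≤ 2/(π|x|²)`
  have hc₁b : c₁ ≤ 2 / (π * ‖x‖ ^ 2) := by
    rw [hc₁, inv_eq_one_div, div_le_div_iff₀ (by positivity) (by positivity)]
    have h2 := pow_le_pow_left₀ (by positivity) hd 2
    nlinarith [Real.pi_pos, h2]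
  -- `|c₁ − c₂| |x| ≤ 5|y|/(π|x|²)`
  have hdiff : |c₁ - c₂| * ‖x‖ ≤ 5 * ‖y‖ / (π * ‖x‖ ^ 2) := by
    have hsq : ‖x - y‖ ^ 2 = ‖x‖ ^ 2 - 2 * ⟪x, y⟫ + ‖y‖ ^ 2 := norm_sub_sq_real x y
    have hin : |⟪x, y⟫| ≤ ‖x‖ * ‖y‖ := abs_real_inner_le_norm x y
    have hnum : |‖x‖ ^ 2 - ‖x - y‖ ^ 2| ≤ 5 / 2 * (‖x‖ * ‖y‖) := by
      rw [hsq]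
      have := abs_le.1 hin
      refine abs_le.2 ⟨?_, ?_⟩ <;> nlinarith [norm_nonneg y, hxy, norm_nonneg x]
    have he : c₁ - c₂ = (2 * π)⁻¹ * ((‖x‖ ^ 2 - ‖x - y‖ ^ 2) / (‖x - y‖ ^ 2 * ‖x‖ ^ 2)) := by
      rw [hc₁, hc₂]
      field_simp
    rw [he, abs_mul, abs_of_pos (by positivity : (0:ℝ) < (2 * π)⁻¹), abs_div,
      abs_of_pos (by positivity : (0:ℝ) < ‖x - y‖ ^ 2 * ‖x‖ ^ 2)]
    have h4 : (1 : ℝ) / ‖x - y‖ ^ 2 ≤ 4 / ‖x‖ ^ 2 := by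
      rw [div_le_div_iff₀ (by positivity) (by positivity)]
      nlinarith [hd, hx0]
    calc (2 * π)⁻¹ * (|‖x‖ ^ 2 - ‖x - y‖ ^ 2| / (‖x - y‖ ^ 2 * ‖x‖ ^ 2)) * ‖x‖
        = (2 * π)⁻¹ * |‖x‖ ^ 2 - ‖x - y‖ ^ 2| / ‖x‖ * (1 / ‖x - y‖ ^ 2) := by
          field_simp
      _ ≤ (2 * π)⁻¹ * (5 / 2 * (‖x‖ * ‖y‖)) / ‖x‖ * (4 / ‖x‖ ^ 2) := by gcongr
      _ = 5 * ‖y‖ / (π * ‖x‖ ^ 2) := by field_simp; ring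
  have hπ3 : (3 : ℝ) < π := Real.pi_gt_three
  calc ‖(c₁ - c₂) • perp x - c₁ • perp y‖ ≤ |c₁ - c₂| * ‖x‖ + c₁ * ‖y‖ := hn1
    _ ≤ 5 * ‖y‖ / (π * ‖x‖ ^ 2) + 2 / (π * ‖x‖ ^ 2) * ‖y‖ :=
        add_le_add hdiff (mul_le_mul_of_nonneg_right hc₁b (norm_nonneg _))
    _ = (7 / π) * (‖y‖ / ‖x‖ ^ 2) := by field_simp; ring
    _ ≤ 3 * (‖y‖ / ‖x‖ ^ 2) := by
        refine mul_le_mul_of_nonneg_right ?_ (by positivity)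
        rw [div_le_iff₀ Real.pi_pos]; linarith
    _ = 3 * ‖y‖ / ‖x‖ ^ 2 := by ring

/-! ### The function `g = ⟪v, x⟫ = −∂_θψ` -/

section Basics

variable {w : EuclideanSpace ℝ (Fin 2) → ℝ} (hw : ContDiff ℝ 1 w) (hwc : HasCompactSupport w)
include hw hwc

/-- `⟪v(x), x⟫ = −∂_θψ(x)` with `ψ = N ∗ w`. [folklore] -/
theorem inner_biotSavart2D_eq_neg_fderiv_logPotential_perp (x : EuclideanSpace ℝ (Fin 2)) :
    ⟪biotSavart2D w x, x⟫ =
      -fderiv ℝ (fun x => ∫ y, w y * ((2 * π)⁻¹ * Real.log ‖x - y‖)) x (perp x) := by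
  rw [fderiv_logPotential_eq hw hwc, inner_perp_perp, neg_neg]

/-- **`g = ⟪v, x⟫` has zero circular means** (it is an angular derivative). [folklore] -/
theorem integral_inner_biotSavart2D_circlePt (r : ℝ) :
    ∫ θ in (-π)..π, ⟪biotSavart2D w (circlePt r θ), circlePt r θ⟫ = 0 := by
  have hψ1 : ContDiff ℝ 1 fun x => ∫ y, w y * ((2 * π)⁻¹ * Real.log ‖x - y‖) :=
    contDiff_logPotential (n := 1) hw hwc
  have h := angCoeff_fderiv_perp hψ1 r 0
  simp only [Int.cast_zero, mul_zero, zero_mul, angCoeff, neg_zero, angExp_zero, one_mul,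
    mul_eq_zero, inv_eq_zero] at h
  rcases h with (h | h) | h
  · norm_num at h
  · exact absurd (Complex.ofReal_eq_zero.1 h) Real.pi_ne_zero
  · rw [intervalIntegral.integral_ofReal, Complex.ofReal_eq_zero] at h
    simp_rw [inner_biotSavart2D_eq_neg_fderiv_logPotential_perp hw hwc]
    rw [intervalIntegral.integral_neg, h, neg_zero]

omit hw hwc in
/-- The velocity of an even vorticity is odd: `v(−x) = −v(x)`. [folklore] -/
theorem biotSavart2D_neg_of_even (heven : ∀ x, w (-x) = w x) (x : EuclideanSpace ℝ (Fin 2)) :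
    biotSavart2D w (-x) = -biotSavart2D w x := by
  have h := biotSavart2D_linearIsometryEquiv (LinearIsometryEquiv.neg ℝ (E := EuclideanSpace ℝ (Fin 2)))
    (ε := 1) (fun z => by simp [perp_neg]) (w := w) (fun y => by simpa using heven y) x
  simpa using h

omit hw hwc in
/-- For an even vorticity, `g = ⟪v, x⟫` is even. [folklore] -/
theorem inner_biotSavart2D_neg_of_even (heven : ∀ x, w (-x) = w x) (x : EuclideanSpace ℝ (Fin 2)) :
    ⟪biotSavart2D w (-x), -x⟫ = ⟪biotSavart2D w x, x⟫ := by
  rw [biotSavart2D_neg_of_even heven, inner_neg_neg]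

omit hw in
/-- `g = ⟪v, x⟫ ∈ C^n` for `w ∈ C^n_c`. [folklore] -/
theorem contDiff_inner_biotSavart2D_id {n : ℕ∞} (hw : ContDiff ℝ n w) :
    ContDiff ℝ n fun x => ⟪biotSavart2D w x, x⟫ :=
  (contDiff_biotSavart2D hw hwc).inner ℝ contDiff_id

/-- `∂ᵢ g = ⟪∂ᵢv, x⟫ + vᵢ` with `∂ᵢv = K ∗ ∂ᵢw`. [folklore] -/
theorem fderiv_inner_biotSavart2D_id (x h : EuclideanSpace ℝ (Fin 2)) :
    fderiv ℝ (fun x => ⟪biotSavart2D w x, x⟫) x h =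
      ⟪biotSavart2D (fun y => fderiv ℝ w y h) x, x⟫ + ⟪biotSavart2D w x, h⟫ := by
  have hv : HasFDerivAt (biotSavart2D w) (fderiv ℝ (biotSavart2D w) x) x :=
    (((contDiff_biotSavart2D hw hwc).differentiable one_ne_zero) x).hasFDerivAt
  have hid : HasFDerivAt (fun y : EuclideanSpace ℝ (Fin 2) => y)
      (ContinuousLinearMap.id ℝ (EuclideanSpace ℝ (Fin 2))) x := hasFDerivAt_id x
  rw [(hv.inner ℝ hid).fderiv]
  simp only [ContinuousLinearMap.comp_apply, ContinuousLinearMap.prod_apply, fderivInnerCLM_apply,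
    ContinuousLinearMap.id_apply, fderiv_biotSavart2D_apply hw hwc]
  ring

end Basics

/-! ### `Δg = −∂_θw` -/

/-- The Laplacian on `ℝ²` in coordinates for a `C²` function (private copy, see
`GaussianVortexPlanarLinear.laplacian_eq_fin_two`). [folklore] -/
private theorem laplacian_eq_fin_two' {φ : EuclideanSpace ℝ (Fin 2) → ℝ}
    (hφ : ContDiff ℝ 2 φ) (x : EuclideanSpace ℝ (Fin 2)) :
    Δ φ x = fderiv ℝ (fun y => fderiv ℝ φ y (EuclideanSpace.single 0 1)) x (EuclideanSpace.single 0 1) +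
      fderiv ℝ (fun y => fderiv ℝ φ y (EuclideanSpace.single 1 1)) x (EuclideanSpace.single 1 1) := by
  have h := congrFun (InnerProductSpace.laplacian_eq_iteratedFDeriv_orthonormalBasis φ
    (EuclideanSpace.basisFun (Fin 2) ℝ)) x
  rw [h]
  simp only [Fin.sum_univ_two, EuclideanSpace.basisFun_apply]
  have h2 : ∀ v : EuclideanSpace ℝ (Fin 2), iteratedFDeriv ℝ 2 φ x ![v, v] =
      fderiv ℝ (fun y => fderiv ℝ φ y v) x v := by
    intro v
    rw [iteratedFDeriv_two_apply, fderiv_clm_apply (((hφ.fderiv_right (m := 1) (by norm_num)).differentiable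
      one_ne_zero) x) (differentiableAt_const v)]
    simp
  rw [h2, h2]

section LaplacianIdentity

variable {w : EuclideanSpace ℝ (Fin 2) → ℝ} (hw : ContDiff ℝ 2 w) (hwc : HasCompactSupport w)
include hw hwc

omit hw hwc in
/-- Components commute with derivatives: `(D v(x) h)_j = D(v_j)(x) h` for `v = K ∗ w ∈ C¹`.
[folklore] -/
theorem fderiv_biotSavart2D_apply_coord {g : EuclideanSpace ℝ (Fin 2) → ℝ} (hg : ContDiff ℝ 1 g) (hgc : HasCompactSupport g)
    (x h : EuclideanSpace ℝ (Fin 2)) (j : Fin 2) :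
    fderiv ℝ (fun y => biotSavart2D g y j) x h = fderiv ℝ (biotSavart2D g) x h j := by
  have hv : DifferentiableAt ℝ (biotSavart2D g) x := ((contDiff_biotSavart2D hg hgc).differentiable one_ne_zero) x
  have h1 := ((EuclideanSpace.proj (𝕜 := ℝ) j).hasFDerivAt.comp x hv.hasFDerivAt).fderiv
  have h2 : (fun y => biotSavart2D g y j) = (EuclideanSpace.proj (𝕜 := ℝ) j) ∘ biotSavart2D g := by
    funext y; simp
  rw [h2, h1]
  simp

omit hw hwc in
/-- Symmetry of the second derivative of the (vector-valued) velocity. [folklore] -/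
theorem fderiv_fderiv_biotSavart2D_symm {g : EuclideanSpace ℝ (Fin 2) → ℝ} (hg : ContDiff ℝ 2 g) (hgc : HasCompactSupport g)
    (x a b : EuclideanSpace ℝ (Fin 2)) :
    fderiv ℝ (fun y => fderiv ℝ (biotSavart2D g) y a) x b = fderiv ℝ (fun y => fderiv ℝ (biotSavart2D g) y b) x a := by
  have hv : ContDiff ℝ 2 (biotSavart2D g) := contDiff_biotSavart2D hg hgc
  have hd : DifferentiableAt ℝ (fderiv ℝ (biotSavart2D g)) x :=
    ((hv.fderiv_right (m := 1) (by norm_num)).differentiable one_ne_zero) x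
  rw [fderiv_clm_apply hd (differentiableAt_const a), fderiv_clm_apply hd (differentiableAt_const b)]
  simp only [fderiv_fun_const, Pi.zero_apply, ContinuousLinearMap.comp_zero, zero_add,
    ContinuousLinearMap.flip_apply]
  exact ((hv.contDiffAt (x := x)).isSymmSndFDerivAt (by simp)).eq _ _

/-- **`Δv = (∇w)^⊥`, first component**: `(Δv)₀ = −∂₁w`. [folklore] -/
theorem laplacian_biotSavart2D_fst (x : EuclideanSpace ℝ (Fin 2)) :
    fderiv ℝ (fun y => biotSavart2D (fun z => fderiv ℝ w z (EuclideanSpace.single 0 1)) y 0) x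
        (EuclideanSpace.single 0 1) +
      fderiv ℝ (fun y => biotSavart2D (fun z => fderiv ℝ w z (EuclideanSpace.single 1 1)) y 0) x
        (EuclideanSpace.single 1 1) = -fderiv ℝ w x (EuclideanSpace.single 1 1) := by
  have hw1 : ContDiff ℝ 1 w := hw.of_le one_le_two
  have hv : ContDiff ℝ 2 (biotSavart2D w) := contDiff_biotSavart2D hw hwc
  -- the first derivatives `V i = D v eᵢ = K ∗ ∂ᵢw`, as functions
  have hV : ∀ i : Fin 2, (fun y => fderiv ℝ (biotSavart2D w) y (EuclideanSpace.single i 1)) =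
      biotSavart2D (fun z => fderiv ℝ w z (EuclideanSpace.single i 1)) := fun i =>
    funext fun y => fderiv_biotSavart2D_apply hw1 hwc y _
  have hVd : ∀ i : Fin 2, ContDiff ℝ 1 fun y => fderiv ℝ (biotSavart2D w) y (EuclideanSpace.single i 1) :=
    fun i => (hv.fderiv_right (m := 1) (by norm_num)).clm_apply contDiff_const
  have hVjd : ∀ i j : Fin 2, Differentiable ℝ fun y => fderiv ℝ (biotSavart2D w) y (EuclideanSpace.single i 1) j :=
    fun i j => (EuclideanSpace.proj (𝕜 := ℝ) j).differentiable.comp ((hVd i).differentiable one_ne_zero)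
  -- components of second derivatives: `D k i j = ∂ₖ (V i)ⱼ`
  set D : Fin 2 → Fin 2 → Fin 2 → ℝ := fun k i j =>
    fderiv ℝ (fun y => fderiv ℝ (biotSavart2D w) y (EuclideanSpace.single i 1) j) x (EuclideanSpace.single k 1)
    with hD
  -- div differentiated
  have hdiv : ∀ k : Fin 2, D k 0 0 + D k 1 1 = 0 := by
    intro k
    have hf : (fun y => fderiv ℝ (biotSavart2D w) y (EuclideanSpace.single 0 1) 0 +
        fderiv ℝ (biotSavart2D w) y (EuclideanSpace.single 1 1) 1) = fun _ => (0:ℝ) :=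
      funext fun y => div_biotSavart2D_eq_zero hw1 hwc y
    have := congrArg (fun F => fderiv ℝ F x (EuclideanSpace.single k 1)) hf
    simp only [fderiv_fun_const, Pi.zero_apply, _root_.zero_apply] at this
    rw [fderiv_fun_add ((hVjd 0 0) x) ((hVjd 1 1) x)] at this
    simpa [hD] using this
  -- curl differentiated
  have hcurl : ∀ k : Fin 2, D k 0 1 - D k 1 0 = fderiv ℝ w x (EuclideanSpace.single k 1) := by
    intro k
    have hf : (fun y => fderiv ℝ (biotSavart2D w) y (EuclideanSpace.single 0 1) 1 -
        fderiv ℝ (biotSavart2D w) y (EuclideanSpace.single 1 1) 0) = w :=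
      funext fun y => curl_biotSavart2D_eq hw1 hwc y
    have := congrArg (fun F => fderiv ℝ F x (EuclideanSpace.single k 1)) hf
    simp only at this
    rw [fderiv_fun_sub ((hVjd 0 1) x) ((hVjd 1 0) x)] at this
    simpa [hD] using this
  -- symmetry, componentwise
  have hsym : ∀ j : Fin 2, D 1 0 j = D 0 1 j := by
    intro j
    have h := congrArg (fun z : EuclideanSpace ℝ (Fin 2) => z j) (fderiv_fderiv_biotSavart2D_symm hw hwc x
      (EuclideanSpace.single 0 1) (EuclideanSpace.single 1 1))
    simp only at h
    have e1 : D 1 0 j = fderiv ℝ (fun y => fderiv ℝ (biotSavart2D w) y (EuclideanSpace.single 0 1)) x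
        (EuclideanSpace.single 1 1) j := by
      simp only [hD]
      have := ((EuclideanSpace.proj (𝕜 := ℝ) j).hasFDerivAt.comp x
        (((hVd 0).differentiable one_ne_zero) x).hasFDerivAt).fderiv
      rw [show (fun y => fderiv ℝ (biotSavart2D w) y (EuclideanSpace.single 0 1) j) =
        (EuclideanSpace.proj (𝕜 := ℝ) j) ∘ (fun y => fderiv ℝ (biotSavart2D w) y (EuclideanSpace.single 0 1))
        from funext fun y => by simp, this]
      simp
    have e2 : D 0 1 j = fderiv ℝ (fun y => fderiv ℝ (biotSavart2D w) y (EuclideanSpace.single 1 1)) x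
        (EuclideanSpace.single 0 1) j := by
      simp only [hD]
      have := ((EuclideanSpace.proj (𝕜 := ℝ) j).hasFDerivAt.comp x
        (((hVd 1).differentiable one_ne_zero) x).hasFDerivAt).fderiv
      rw [show (fun y => fderiv ℝ (biotSavart2D w) y (EuclideanSpace.single 1 1) j) =
        (EuclideanSpace.proj (𝕜 := ℝ) j) ∘ (fun y => fderiv ℝ (biotSavart2D w) y (EuclideanSpace.single 1 1))
        from funext fun y => by simp, this]
      simp
    rw [e1, e2, h]
  -- conclude: the goal is `D 0 0 0 + D 1 1 0 = -∂₁w`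
  have goal_eq : fderiv ℝ (fun y => biotSavart2D (fun z => fderiv ℝ w z (EuclideanSpace.single 0 1)) y 0) x
        (EuclideanSpace.single 0 1) = D 0 0 0 ∧
      fderiv ℝ (fun y => biotSavart2D (fun z => fderiv ℝ w z (EuclideanSpace.single 1 1)) y 0) x
        (EuclideanSpace.single 1 1) = D 1 1 0 := by
    refine ⟨?_, ?_⟩ <;> simp only [hD, ← hV]
  rw [goal_eq.1, goal_eq.2]
  have h1 := hdiv 0
  have h2 := hcurl 1
  have h3 := hsym 1
  linarith

/-- **`Δv = (∇w)^⊥`, second component**: `(Δv)₁ = ∂₀w`. [folklore] -/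
theorem laplacian_biotSavart2D_snd (x : EuclideanSpace ℝ (Fin 2)) :
    fderiv ℝ (fun y => biotSavart2D (fun z => fderiv ℝ w z (EuclideanSpace.single 0 1)) y 1) x
        (EuclideanSpace.single 0 1) +
      fderiv ℝ (fun y => biotSavart2D (fun z => fderiv ℝ w z (EuclideanSpace.single 1 1)) y 1) x
        (EuclideanSpace.single 1 1) = fderiv ℝ w x (EuclideanSpace.single 0 1) := by
  have hw1 : ContDiff ℝ 1 w := hw.of_le one_le_two
  have hv : ContDiff ℝ 2 (biotSavart2D w) := contDiff_biotSavart2D hw hwc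
  have hV : ∀ i : Fin 2, (fun y => fderiv ℝ (biotSavart2D w) y (EuclideanSpace.single i 1)) =
      biotSavart2D (fun z => fderiv ℝ w z (EuclideanSpace.single i 1)) := fun i =>
    funext fun y => fderiv_biotSavart2D_apply hw1 hwc y _
  have hVd : ∀ i : Fin 2, ContDiff ℝ 1 fun y => fderiv ℝ (biotSavart2D w) y (EuclideanSpace.single i 1) :=
    fun i => (hv.fderiv_right (m := 1) (by norm_num)).clm_apply contDiff_const
  have hVjd : ∀ i j : Fin 2, Differentiable ℝ fun y => fderiv ℝ (biotSavart2D w) y (EuclideanSpace.single i 1) j :=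
    fun i j => (EuclideanSpace.proj (𝕜 := ℝ) j).differentiable.comp ((hVd i).differentiable one_ne_zero)
  set D : Fin 2 → Fin 2 → Fin 2 → ℝ := fun k i j =>
    fderiv ℝ (fun y => fderiv ℝ (biotSavart2D w) y (EuclideanSpace.single i 1) j) x (EuclideanSpace.single k 1)
    with hD
  have hdiv : ∀ k : Fin 2, D k 0 0 + D k 1 1 = 0 := by
    intro k
    have hf : (fun y => fderiv ℝ (biotSavart2D w) y (EuclideanSpace.single 0 1) 0 +
        fderiv ℝ (biotSavart2D w) y (EuclideanSpace.single 1 1) 1) = fun _ => (0:ℝ) :=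
      funext fun y => div_biotSavart2D_eq_zero hw1 hwc y
    have := congrArg (fun F => fderiv ℝ F x (EuclideanSpace.single k 1)) hf
    simp only [fderiv_fun_const, Pi.zero_apply, _root_.zero_apply] at this
    rw [fderiv_fun_add ((hVjd 0 0) x) ((hVjd 1 1) x)] at this
    simpa [hD] using this
  have hcurl : ∀ k : Fin 2, D k 0 1 - D k 1 0 = fderiv ℝ w x (EuclideanSpace.single k 1) := by
    intro k
    have hf : (fun y => fderiv ℝ (biotSavart2D w) y (EuclideanSpace.single 0 1) 1 -
        fderiv ℝ (biotSavart2D w) y (EuclideanSpace.single 1 1) 0) = w :=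
      funext fun y => curl_biotSavart2D_eq hw1 hwc y
    have := congrArg (fun F => fderiv ℝ F x (EuclideanSpace.single k 1)) hf
    simp only at this
    rw [fderiv_fun_sub ((hVjd 0 1) x) ((hVjd 1 0) x)] at this
    simpa [hD] using this
  have hsym : ∀ j : Fin 2, D 1 0 j = D 0 1 j := by
    intro j
    have h := congrArg (fun z : EuclideanSpace ℝ (Fin 2) => z j) (fderiv_fderiv_biotSavart2D_symm hw hwc x
      (EuclideanSpace.single 0 1) (EuclideanSpace.single 1 1))
    simp only at h
    have e1 : D 1 0 j = fderiv ℝ (fun y => fderiv ℝ (biotSavart2D w) y (EuclideanSpace.single 0 1)) x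
        (EuclideanSpace.single 1 1) j := by
      simp only [hD]
      have := ((EuclideanSpace.proj (𝕜 := ℝ) j).hasFDerivAt.comp x
        (((hVd 0).differentiable one_ne_zero) x).hasFDerivAt).fderiv
      rw [show (fun y => fderiv ℝ (biotSavart2D w) y (EuclideanSpace.single 0 1) j) =
        (EuclideanSpace.proj (𝕜 := ℝ) j) ∘ (fun y => fderiv ℝ (biotSavart2D w) y (EuclideanSpace.single 0 1))
        from funext fun y => by simp, this]
      simp
    have e2 : D 0 1 j = fderiv ℝ (fun y => fderiv ℝ (biotSavart2D w) y (EuclideanSpace.single 1 1)) x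
        (EuclideanSpace.single 0 1) j := by
      simp only [hD]
      have := ((EuclideanSpace.proj (𝕜 := ℝ) j).hasFDerivAt.comp x
        (((hVd 1).differentiable one_ne_zero) x).hasFDerivAt).fderiv
      rw [show (fun y => fderiv ℝ (biotSavart2D w) y (EuclideanSpace.single 1 1) j) =
        (EuclideanSpace.proj (𝕜 := ℝ) j) ∘ (fun y => fderiv ℝ (biotSavart2D w) y (EuclideanSpace.single 1 1))
        from funext fun y => by simp, this]
      simp
    rw [e1, e2, h]
  have goal_eq : fderiv ℝ (fun y => biotSavart2D (fun z => fderiv ℝ w z (EuclideanSpace.single 0 1)) y 1) x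
        (EuclideanSpace.single 0 1) = D 0 0 1 ∧
      fderiv ℝ (fun y => biotSavart2D (fun z => fderiv ℝ w z (EuclideanSpace.single 1 1)) y 1) x
        (EuclideanSpace.single 1 1) = D 1 1 1 := by
    refine ⟨?_, ?_⟩ <;> simp only [hD, ← hV]
  rw [goal_eq.1, goal_eq.2]
  have h1 := hdiv 1
  have h2 := hcurl 0
  have h3 := hsym 0
  linarith

/-- **`Δ⟪v, x⟫ = −∂_θw`** for `w ∈ C²_c` (`Δ⟪v,x⟫ = ⟪Δv, x⟫ + 2 div v`, `Δv = (∇w)^⊥`, `div v = 0`).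
[folklore] -/
theorem laplacian_inner_biotSavart2D_id (x : EuclideanSpace ℝ (Fin 2)) :
    Δ (fun y => ⟪biotSavart2D w y, y⟫) x = -fderiv ℝ w x (perp x) := by
  have hw1 : ContDiff ℝ 1 w := hw.of_le one_le_two
  have hg2 : ContDiff ℝ 2 fun y => ⟪biotSavart2D w y, y⟫ := contDiff_inner_biotSavart2D_id hwc hw
  rw [laplacian_eq_fin_two' hg2]
  -- first derivatives as functions
  have hdi : ∀ i : Fin 2, ContDiff ℝ 1 fun z => fderiv ℝ w z (EuclideanSpace.single i 1) := fun i =>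
    (hw.fderiv_right (m := 1) (by norm_num)).clm_apply contDiff_const
  have hds : ∀ i : Fin 2, HasCompactSupport fun z => fderiv ℝ w z (EuclideanSpace.single i 1) :=
    fun i => hwc.fderiv_apply (𝕜 := ℝ) _
  have h1 : ∀ i : Fin 2, (fun y => fderiv ℝ (fun y => ⟪biotSavart2D w y, y⟫) y (EuclideanSpace.single i 1)) =
      fun y => ⟪biotSavart2D (fun z => fderiv ℝ w z (EuclideanSpace.single i 1)) y, y⟫ +
        biotSavart2D w y i := by
    intro i; funext y
    rw [fderiv_inner_biotSavart2D_id hw1 hwc, EuclideanSpace.inner_single_right]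
    simp
  -- second derivatives
  have h2 : ∀ i : Fin 2, fderiv ℝ (fun y => ⟪biotSavart2D (fun z => fderiv ℝ w z (EuclideanSpace.single i 1)) y, y⟫ +
      biotSavart2D w y i) x (EuclideanSpace.single i 1) =
      (⟪biotSavart2D (fun z => fderiv ℝ (fun z => fderiv ℝ w z (EuclideanSpace.single i 1)) z
        (EuclideanSpace.single i 1)) x, x⟫ +
        biotSavart2D (fun z => fderiv ℝ w z (EuclideanSpace.single i 1)) x i) +
      fderiv ℝ (biotSavart2D w) x (EuclideanSpace.single i 1) i := by
    intro i
    have hA : DifferentiableAt ℝ (fun y => ⟪biotSavart2D (fun z => fderiv ℝ w z (EuclideanSpace.single i 1)) y, y⟫) x :=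
      ((contDiff_inner_biotSavart2D_id (hds i) (hdi i)).differentiable one_ne_zero) x
    have hB : DifferentiableAt ℝ (fun y => biotSavart2D w y i) x :=
      ((EuclideanSpace.proj (𝕜 := ℝ) i).differentiable.comp
        ((contDiff_biotSavart2D hw1 hwc).differentiable one_ne_zero)) x
    rw [fderiv_fun_add hA hB, _root_.add_apply, fderiv_inner_biotSavart2D_id (hdi i) (hds i),
      EuclideanSpace.inner_single_right, fderiv_biotSavart2D_apply_coord hw1 hwc]
    simp
  simp only [h1, h2]
  -- `∂ᵢ v = K ∗ ∂ᵢ w` (components)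
  have hV : ∀ i j : Fin 2, fderiv ℝ (biotSavart2D w) x (EuclideanSpace.single i 1) j =
      biotSavart2D (fun z => fderiv ℝ w z (EuclideanSpace.single i 1)) x j := fun i j => by
    rw [fderiv_biotSavart2D_apply hw1 hwc]
  have hdiv := div_biotSavart2D_eq_zero hw1 hwc x
  rw [hV, hV] at hdiv
  -- second derivatives of `v`, components, via `K ∗ ∂ᵢ∂ᵢw = ∂ᵢ(K ∗ ∂ᵢ w)`
  have hVV : ∀ i j : Fin 2, biotSavart2D (fun z => fderiv ℝ (fun z => fderiv ℝ w z (EuclideanSpace.single i 1)) z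
      (EuclideanSpace.single i 1)) x j =
      fderiv ℝ (fun y => biotSavart2D (fun z => fderiv ℝ w z (EuclideanSpace.single i 1)) y j) x
        (EuclideanSpace.single i 1) := by
    intro i j
    rw [fderiv_biotSavart2D_apply_coord (hdi i) (hds i), fderiv_biotSavart2D_apply (hdi i) (hds i)]
  have hL0 := laplacian_biotSavart2D_fst hw hwc x
  have hL1 := laplacian_biotSavart2D_snd hw hwc x
  rw [inner_fin_two, inner_fin_two, hVV, hVV, hVV, hVV, fderiv_perp_eq_coord, hV, hV]
  linear_combination x 0 * hL0 + x 1 * hL1 + 2 * hdiv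

end LaplacianIdentity

/-! ### Far-field decay of `K ∗ h` and of `⟪K ∗ h, x⟫` -/

section Decay

variable {h : EuclideanSpace ℝ (Fin 2) → ℝ} (hh : Continuous h) {R : ℝ} (hR : 0 ≤ R)
  (hsupp : ∀ y, R < ‖y‖ → h y = 0)
include hh hR hsupp

omit hR in
/-- `⟪(K ∗ h)(x), x⟫ = ∫ h(y) ⟪K(x−y), y⟫ dy`. [folklore] -/
theorem inner_biotSavart2D_self_eq_integral (x : EuclideanSpace ℝ (Fin 2)) :
    ⟪biotSavart2D h x, x⟫ = ∫ y, h y * ⟪biotSavartKernel2D (x - y), y⟫ := by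
  have hhc : HasCompactSupport h := by
    refine HasCompactSupport.of_support_subset_isCompact (isCompact_closedBall (0 : EuclideanSpace ℝ (Fin 2)) R) fun y hy => ?_
    by_contra hy'
    exact hy (hsupp y (by simpa using hy'))
  obtain ⟨M, hM⟩ := hh.bounded_above_of_compact_support hhc
  have hint := integrable_smul_biotSavartKernel2D (hh.integrable_of_hasCompactSupport hhc)
    (fun y => (Real.norm_eq_abs _).symm.le.trans (hM y)) x
  rw [biotSavart2D, real_inner_comm, ← integral_inner hint]
  refine integral_congr_ae (Eventually.of_forall fun y => ?_)
  simp only [inner_smul_right]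
  rw [← inner_biotSavartKernel2D_sub_left x y]
  congr 1
  exact real_inner_comm _ _

omit hR in
/-- **No moment condition**: `|⟪(K ∗ h)(x), x⟫| ≤ (R/(π|x|)) ‖h‖₁` for `|x| ≥ 2R`, `x ≠ 0`.
[folklore] -/
theorem abs_inner_biotSavart2D_le {x : EuclideanSpace ℝ (Fin 2)} (hx : x ≠ 0) (hxR : 2 * R ≤ ‖x‖) :
    |⟪biotSavart2D h x, x⟫| ≤ R / (π * ‖x‖) * ∫ y, |h y| := by
  have hx0 : 0 < ‖x‖ := norm_pos_iff.2 hx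
  have hhc : HasCompactSupport h := by
    refine HasCompactSupport.of_support_subset_isCompact (isCompact_closedBall (0 : EuclideanSpace ℝ (Fin 2)) R) fun y hy => ?_
    by_contra hy'
    exact hy (hsupp y (by simpa using hy'))
  have hi : Integrable fun y => |h y| := (hh.integrable_of_hasCompactSupport hhc).abs
  rw [inner_biotSavart2D_self_eq_integral hh hsupp, ← integral_const_mul, ← Real.norm_eq_abs]
  refine norm_integral_le_of_norm_le (hi.const_mul _) (Eventually.of_forall fun y => ?_)
  rw [Real.norm_eq_abs, abs_mul]
  rcases lt_or_ge R ‖y‖ with hy | hy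
  · rw [hsupp y hy]; simp
  · have hxy : ‖x‖ / 2 ≤ ‖x - y‖ := by have := norm_sub_norm_le x y; linarith
    have hxy0 : 0 < ‖x - y‖ := by linarith
    have hk : |⟪biotSavartKernel2D (x - y), y⟫| ≤ R / (π * ‖x‖) := by
      refine (abs_real_inner_le_norm _ _).trans ?_
      rw [norm_biotSavartKernel2D]
      calc (2 * π)⁻¹ * ‖x - y‖⁻¹ * ‖y‖ ≤ (2 * π)⁻¹ * (‖x‖ / 2)⁻¹ * R := by
            gcongr
        _ = R / (π * ‖x‖) := by field_simp
    calc |h y| * |⟪biotSavartKernel2D (x - y), y⟫| ≤ |h y| * (R / (π * ‖x‖)) :=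
          mul_le_mul_of_nonneg_left hk (abs_nonneg _)
      _ = R / (π * ‖x‖) * |h y| := mul_comm _ _

omit hR in
/-- **Mass zero**: `‖(K ∗ h)(x)‖ ≤ (3R/|x|²) ‖h‖₁` for `|x| ≥ 2R`, `x ≠ 0`, if `∫ h = 0`. [folklore] -/
theorem norm_biotSavart2D_le_of_integral_eq_zero (hmass : ∫ y, h y = 0) {x : EuclideanSpace ℝ (Fin 2)} (hx : x ≠ 0)
    (hxR : 2 * R ≤ ‖x‖) :
    ‖biotSavart2D h x‖ ≤ 3 * R / ‖x‖ ^ 2 * ∫ y, |h y| := by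
  have hx0 : 0 < ‖x‖ := norm_pos_iff.2 hx
  have hhc : HasCompactSupport h := by
    refine HasCompactSupport.of_support_subset_isCompact (isCompact_closedBall (0 : EuclideanSpace ℝ (Fin 2)) R) fun y hy => ?_
    by_contra hy'
    exact hy (hsupp y (by simpa using hy'))
  obtain ⟨M, hM⟩ := hh.bounded_above_of_compact_support hhc
  have hint := integrable_smul_biotSavartKernel2D (hh.integrable_of_hasCompactSupport hhc)
    (fun y => (Real.norm_eq_abs _).symm.le.trans (hM y)) x
  have hi1 : Integrable h := hh.integrable_of_hasCompactSupport hhc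
  have hi : Integrable fun y => |h y| := hi1.abs
  have heq : biotSavart2D h x = ∫ y, h y • (biotSavartKernel2D (x - y) - biotSavartKernel2D x) := by
    rw [biotSavart2D]
    simp_rw [smul_sub]
    rw [integral_sub hint (hi1.smul_const _), integral_smul_const, hmass, zero_smul, sub_zero]
  rw [heq, ← integral_const_mul]
  refine norm_integral_le_of_norm_le (hi.const_mul _) (Eventually.of_forall fun y => ?_)
  rw [norm_smul, Real.norm_eq_abs]
  rcases lt_or_ge R ‖y‖ with hy | hy
  · rw [hsupp y hy]; simp
  · have hk := norm_biotSavartKernel2D_sub_sub_le hx (by linarith : 2 * ‖y‖ ≤ ‖x‖)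
    calc |h y| * ‖biotSavartKernel2D (x - y) - biotSavartKernel2D x‖ ≤ |h y| * (3 * ‖y‖ / ‖x‖ ^ 2) :=
          mul_le_mul_of_nonneg_left hk (abs_nonneg _)
      _ ≤ |h y| * (3 * R / ‖x‖ ^ 2) := by gcongr
      _ = 3 * R / ‖x‖ ^ 2 * |h y| := mul_comm _ _

/-- **First moments zero**: `|⟪(K ∗ h)(x), x⟫| ≤ (3R²/|x|²) ‖h‖₁` for `|x| ≥ 2R`, `x ≠ 0`, if
`∫ h(y) y_k dy = 0` (`k = 0, 1`). [folklore] -/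
theorem abs_inner_biotSavart2D_le_of_moments_eq_zero (hmom : ∀ k : Fin 2, ∫ y, h y * y k = 0) {x : EuclideanSpace ℝ (Fin 2)}
    (hx : x ≠ 0) (hxR : 2 * R ≤ ‖x‖) :
    |⟪biotSavart2D h x, x⟫| ≤ 3 * R ^ 2 / ‖x‖ ^ 2 * ∫ y, |h y| := by
  have hx0 : 0 < ‖x‖ := norm_pos_iff.2 hx
  have hhc : HasCompactSupport h := by
    refine HasCompactSupport.of_support_subset_isCompact (isCompact_closedBall (0 : EuclideanSpace ℝ (Fin 2)) R) fun y hy => ?_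
    by_contra hy'
    exact hy (hsupp y (by simpa using hy'))
  have hi1 : Integrable h := hh.integrable_of_hasCompactSupport hhc
  have hi : Integrable fun y => |h y| := hi1.abs
  have hpj : ∀ k : Fin 2, Continuous fun y : EuclideanSpace ℝ (Fin 2) => y k := fun k =>
    (EuclideanSpace.proj (k : Fin 2) : EuclideanSpace ℝ (Fin 2) →L[ℝ] ℝ).continuous
  have him : ∀ k : Fin 2, Integrable fun y => h y * y k := fun k =>
    ((hh.mul (hpj k)).integrable_of_hasCompactSupport hhc.mul_right)
  -- split the kernel
  have hK : ∀ y, ⟪biotSavartKernel2D (x - y), y⟫ =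
      ⟪biotSavartKernel2D (x - y) - biotSavartKernel2D x, y⟫ +
        (biotSavartKernel2D x 0 * y 0 + biotSavartKernel2D x 1 * y 1) := by
    intro y; rw [inner_sub_left, inner_fin_two (biotSavartKernel2D x) y]; ring
  have hpt : ∀ y, |h y * ⟪biotSavartKernel2D (x - y) - biotSavartKernel2D x, y⟫| ≤ 3 * R ^ 2 / ‖x‖ ^ 2 * |h y| := by
    intro y
    rw [abs_mul]
    rcases lt_or_ge R ‖y‖ with hy | hy
    · rw [hsupp y hy]; simp
    · have hk := norm_biotSavartKernel2D_sub_sub_le hx (by linarith : 2 * ‖y‖ ≤ ‖x‖)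
      calc |h y| * |⟪biotSavartKernel2D (x - y) - biotSavartKernel2D x, y⟫|
          ≤ |h y| * (3 * ‖y‖ / ‖x‖ ^ 2 * ‖y‖) :=
            mul_le_mul_of_nonneg_left ((abs_real_inner_le_norm _ _).trans (by gcongr)) (abs_nonneg _)
        _ ≤ |h y| * (3 * R / ‖x‖ ^ 2 * R) := by gcongr
        _ = 3 * R ^ 2 / ‖x‖ ^ 2 * |h y| := by ring
  have hid : Integrable fun y => h y * ⟪biotSavartKernel2D (x - y) - biotSavartKernel2D x, y⟫ := by
    refine (hi.const_mul (3 * R ^ 2 / ‖x‖ ^ 2)).mono' ?_ (Eventually.of_forall fun y => ?_)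
    · exact (hh.measurable.mul ((((measurable_biotSavartKernel2D.comp (measurable_const.sub measurable_id)).sub
        measurable_const).inner measurable_id))).aestronglyMeasurable
    · rw [Real.norm_eq_abs]; exact hpt y
  have heq : ⟪biotSavart2D h x, x⟫ = ∫ y, h y * ⟪biotSavartKernel2D (x - y) - biotSavartKernel2D x, y⟫ := by
    rw [inner_biotSavart2D_self_eq_integral hh hsupp]
    simp_rw [hK]
    have h2 : ∀ y, h y * (⟪biotSavartKernel2D (x - y) - biotSavartKernel2D x, y⟫ +
        (biotSavartKernel2D x 0 * y 0 + biotSavartKernel2D x 1 * y 1)) =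
        h y * ⟪biotSavartKernel2D (x - y) - biotSavartKernel2D x, y⟫ +
          (biotSavartKernel2D x 0 * (h y * y 0) + biotSavartKernel2D x 1 * (h y * y 1)) := fun y => by ring
    simp_rw [h2]
    have i2 : Integrable fun y => biotSavartKernel2D x 0 * (h y * y 0) + biotSavartKernel2D x 1 * (h y * y 1) :=
      ((him 0).const_mul _).add ((him 1).const_mul _)
    rw [integral_add hid i2, integral_add ((him 0).const_mul _) ((him 1).const_mul _), integral_const_mul,
      integral_const_mul, hmom 0, hmom 1]
    ring
  rw [heq, ← integral_const_mul, ← Real.norm_eq_abs]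
  exact norm_integral_le_of_norm_le (hi.const_mul _) (Eventually.of_forall fun y => by
    rw [Real.norm_eq_abs]; exact hpt y)

end Decay

/-! ### Moments of derivatives -/

/-- `∫ ∂ⱼw(y) y_k dy = −δ_{jk} ∫ w` for `w ∈ C¹_c`. [folklore] -/
theorem integral_fderiv_single_mul_coord {w : EuclideanSpace ℝ (Fin 2) → ℝ} (hw : ContDiff ℝ 1 w) (hwc : HasCompactSupport w)
    (j k : Fin 2) :
    ∫ y, fderiv ℝ w y (EuclideanSpace.single j 1) * y k =
      -(EuclideanSpace.single j (1:ℝ) k) * ∫ y, w y := by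
  have hc : Continuous fun y => fderiv ℝ w y (EuclideanSpace.single j 1) :=
    (hw.continuous_fderiv one_ne_zero).clm_apply continuous_const
  have hpk : Continuous fun y : EuclideanSpace ℝ (Fin 2) => y k := (EuclideanSpace.proj (k : Fin 2) : EuclideanSpace ℝ (Fin 2) →L[ℝ] ℝ).continuous
  have hfd : ∀ y : EuclideanSpace ℝ (Fin 2), fderiv ℝ (fun y : EuclideanSpace ℝ (Fin 2) => y k) y (EuclideanSpace.single j 1) =
      EuclideanSpace.single j (1:ℝ) k := fun y => by
    rw [show (fun y : EuclideanSpace ℝ (Fin 2) => y k) = (EuclideanSpace.proj (k : Fin 2) : EuclideanSpace ℝ (Fin 2) →L[ℝ] ℝ) from rfl,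
      ContinuousLinearMap.fderiv]
    simp
  have h := integral_mul_fderiv_eq_neg_fderiv_mul_of_integrable (μ := volume) (f := fun y : EuclideanSpace ℝ (Fin 2) => y k)
    (g := w) (v := EuclideanSpace.single j 1) ?_ ?_ ?_
    (fun x _ => (EuclideanSpace.proj (k : Fin 2) : EuclideanSpace ℝ (Fin 2) →L[ℝ] ℝ).differentiableAt)
    (fun x _ => (hw.differentiable one_ne_zero) x)
  · simp_rw [hfd] at h
    rw [integral_const_mul] at h
    rw [neg_mul, ← h]
    exact integral_congr_ae (Eventually.of_forall fun y => mul_comm _ _)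
  · simp_rw [hfd]; exact (hw.continuous.integrable_of_hasCompactSupport hwc).const_mul _
  · exact (hpk.mul hc).integrable_of_hasCompactSupport ((hwc.fderiv_apply (𝕜 := ℝ) _).mul_left)
  · exact (hpk.mul hw.continuous).integrable_of_hasCompactSupport hwc.mul_left

/-! ### From far-field to global bounds; integrability -/

/-- A continuous function with `|F| ≤ A/|x|^k` far away satisfies `|F| ≤ C/(1+|x|)^k` everywhere.
[folklore] -/
theorem exists_bound_div_one_add_norm_pow {F : EuclideanSpace ℝ (Fin 2) → ℝ} (hF : Continuous F) (k : ℕ) {A R₀ : ℝ}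
    (hdec : ∀ x, R₀ ≤ ‖x‖ → x ≠ 0 → |F x| ≤ A / ‖x‖ ^ k) :
    ∃ C, 0 ≤ C ∧ ∀ x, |F x| ≤ C / (1 + ‖x‖) ^ k := by
  set R₁ := max R₀ 1 with hR₁
  obtain ⟨M, hM⟩ := (isCompact_closedBall (0 : EuclideanSpace ℝ (Fin 2)) R₁).exists_bound_of_continuousOn hF.continuousOn
  refine ⟨max M 0 * (1 + R₁) ^ k + |A| * 2 ^ k, by positivity, fun x => ?_⟩
  have h1 : 0 < 1 + ‖x‖ := by positivity
  rw [le_div_iff₀ (by positivity)]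
  rcases le_or_gt ‖x‖ R₁ with hx | hx
  · have hb : |F x| ≤ max M 0 := ((Real.norm_eq_abs _).symm.le.trans (hM x (by simpa using hx))).trans
      (le_max_left _ _)
    have hp : (1 + ‖x‖) ^ k ≤ (1 + R₁) ^ k := pow_le_pow_left₀ h1.le (by linarith) k
    calc |F x| * (1 + ‖x‖) ^ k ≤ max M 0 * (1 + R₁) ^ k :=
          mul_le_mul hb hp (by positivity) (le_max_right _ _)
      _ ≤ _ := le_add_of_nonneg_right (by positivity)
  · have hx1 : 1 ≤ ‖x‖ := le_trans (le_max_right _ _) hx.le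
    have hx0 : x ≠ 0 := by
      intro h; rw [h, norm_zero] at hx1; linarith
    have hb := hdec x (le_trans (le_max_left _ _) hx.le) hx0
    have hp : (1 + ‖x‖) ^ k ≤ 2 ^ k * ‖x‖ ^ k := by
      rw [← mul_pow]; exact pow_le_pow_left₀ h1.le (by linarith) k
    have hxk : 0 < ‖x‖ ^ k := by positivity
    calc |F x| * (1 + ‖x‖) ^ k ≤ (A / ‖x‖ ^ k) * (2 ^ k * ‖x‖ ^ k) :=
          mul_le_mul hb hp (by positivity) ((abs_nonneg _).trans hb)
      _ = A * 2 ^ k := by field_simp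
      _ ≤ |A| * 2 ^ k := by gcongr; exact le_abs_self A
      _ ≤ _ := le_add_of_nonneg_left (by positivity)

/-- `|F| ≤ C/(1+|x|)^k` with `k > 2` implies integrability on `ℝ²`. [folklore] -/
theorem integrable_of_abs_le_div_one_add_norm_pow {F : EuclideanSpace ℝ (Fin 2) → ℝ} (hF : AEStronglyMeasurable F volume)
    {C : ℝ} {k : ℕ} (hk : 2 < k) (hb : ∀ x, |F x| ≤ C / (1 + ‖x‖) ^ k) : Integrable F := by
  have hr : (Module.finrank ℝ (EuclideanSpace ℝ (Fin 2)) : ℝ) < k := by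
    rw [finrank_euclideanSpace_fin]; exact_mod_cast hk
  have h := (integrable_one_add_norm (E := EuclideanSpace ℝ (Fin 2)) (μ := volume) hr).const_mul C
  refine h.mono' hF (Eventually.of_forall fun x => ?_)
  rw [Real.norm_eq_abs, Real.rpow_neg (by positivity), Real.rpow_natCast, ← div_eq_mul_inv]
  exact hb x

/-! ### Decay of `g = ⟪v, x⟫` and of its derivatives for `∫ w = 0` -/

section DecayG

variable {w : EuclideanSpace ℝ (Fin 2) → ℝ} (hw : ContDiff ℝ 2 w) (hwc : HasCompactSupport w) (hmass : ∫ x, w x = 0)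
include hw hwc

omit hw in
/-- A support radius for `w` and all its derivatives. [folklore] -/
theorem exists_support_radius : ∃ R, 0 ≤ R ∧ (∀ y, R < ‖y‖ → w y = 0) ∧
    (∀ (v : EuclideanSpace ℝ (Fin 2)) (y), R < ‖y‖ → fderiv ℝ w y v = 0) ∧
    (∀ (u v : EuclideanSpace ℝ (Fin 2)) (y), R < ‖y‖ → fderiv ℝ (fun z => fderiv ℝ w z u) y v = 0) := by
  obtain ⟨R, hR⟩ := hwc.isCompact.isBounded.subset_closedBall 0
  refine ⟨max R 0, le_max_right _ _, fun y hy => ?_, fun v y hy => ?_, fun u v y hy => ?_⟩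
  · refine image_eq_zero_of_notMem_tsupport fun h => ?_
    have := hR h; simp at this; linarith [le_max_left R 0]
  · have hy' : y ∉ tsupport w := fun h => by have := hR h; simp at this; linarith [le_max_left R 0]
    have : y ∉ tsupport (fderiv ℝ w · v) := fun h => hy' (tsupport_fderiv_apply_subset ℝ v h)
    exact image_eq_zero_of_notMem_tsupport (f := fun x => fderiv ℝ w x v) this
  · have hy' : y ∉ tsupport w := fun h => by have := hR h; simp at this; linarith [le_max_left R 0]
    have h1 : y ∉ tsupport (fderiv ℝ w · u) := fun h => hy' (tsupport_fderiv_apply_subset ℝ u h)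
    have : y ∉ tsupport (fderiv ℝ (fun z => fderiv ℝ w z u) · v) := fun h =>
      h1 (tsupport_fderiv_apply_subset ℝ v h)
    exact image_eq_zero_of_notMem_tsupport (f := fun x => fderiv ℝ (fun z => fderiv ℝ w z u) x v) this

omit hw in
/-- **`g = O(1/|x|)`**: `|⟪v, x⟫| ≤ C/(1 + |x|)` (no moment condition). [folklore] -/
theorem exists_abs_inner_biotSavart2D_le (hw1 : ContDiff ℝ 1 w) :
    ∃ C, 0 ≤ C ∧ ∀ x, |⟪biotSavart2D w x, x⟫| ≤ C / (1 + ‖x‖) := by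
  obtain ⟨R, hRge, hsupp, -, -⟩ := exists_support_radius hwc
  have hg : Continuous fun x => ⟪biotSavart2D w x, x⟫ := (contDiff_inner_biotSavart2D_id hwc hw1).continuous
  obtain ⟨C, hC0, hC⟩ := exists_bound_div_one_add_norm_pow hg 1 (A := R / π * ∫ y, |w y|) (R₀ := 2 * R)
    fun x hx hx0 => by
      have h := abs_inner_biotSavart2D_le hw1.continuous hsupp hx0 hx
      have hx' : 0 < ‖x‖ := norm_pos_iff.2 hx0
      rwa [pow_one, show (R / π * ∫ y, |w y|) / ‖x‖ = R / (π * ‖x‖) * ∫ y, |w y| by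
        field_simp]
  exact ⟨C, hC0, fun x => by simpa using hC x⟩

/-- `∂ᵢ∂ᵢ g = ⟪K ∗ ∂ᵢ∂ᵢw, x⟫ + 2 (K ∗ ∂ᵢw)ᵢ`. [folklore] -/
theorem fderiv_fderiv_inner_biotSavart2D_id (x : EuclideanSpace ℝ (Fin 2)) (i : Fin 2) :
    fderiv ℝ (fun y => fderiv ℝ (fun y => ⟪biotSavart2D w y, y⟫) y (EuclideanSpace.single i 1)) x (EuclideanSpace.single i 1) =
      ⟪biotSavart2D (fun z => fderiv ℝ (fun z => fderiv ℝ w z (EuclideanSpace.single i 1)) z (EuclideanSpace.single i 1)) x, x⟫ + 2 * biotSavart2D (fun z => fderiv ℝ w z (EuclideanSpace.single i 1)) x i := by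
  have hw1 : ContDiff ℝ 1 w := hw.of_le one_le_two
  have hdi : ContDiff ℝ 1 (fun z => fderiv ℝ w z (EuclideanSpace.single i 1)) := (hw.fderiv_right (m := 1) (by norm_num)).clm_apply contDiff_const
  have hds : HasCompactSupport (fun z => fderiv ℝ w z (EuclideanSpace.single i 1)) := hwc.fderiv_apply (𝕜 := ℝ) _
  have h1 : (fun y => fderiv ℝ (fun y => ⟪biotSavart2D w y, y⟫) y (EuclideanSpace.single i 1)) = fun y => ⟪biotSavart2D (fun z => fderiv ℝ w z (EuclideanSpace.single i 1)) y, y⟫ + biotSavart2D w y i := by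
    funext y
    rw [fderiv_inner_biotSavart2D_id hw1 hwc, EuclideanSpace.inner_single_right]
    simp
  rw [h1]
  have hA : DifferentiableAt ℝ (fun y => ⟪biotSavart2D (fun z => fderiv ℝ w z (EuclideanSpace.single i 1)) y, y⟫) x :=
    ((contDiff_inner_biotSavart2D_id hds hdi).differentiable one_ne_zero) x
  have hB : DifferentiableAt ℝ (fun y => biotSavart2D w y i) x :=
    ((EuclideanSpace.proj (𝕜 := ℝ) i).differentiable.comp
      ((contDiff_biotSavart2D hw1 hwc).differentiable one_ne_zero)) x
  rw [fderiv_fun_add hA hB, _root_.add_apply, fderiv_inner_biotSavart2D_id hdi hds,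
    EuclideanSpace.inner_single_right, fderiv_biotSavart2D_apply_coord hw1 hwc, fderiv_biotSavart2D_apply hw1 hwc]
  simp
  ring

include hmass

/-- **`∇g = O(1/|x|²)`** when `∫ w = 0`. [folklore] -/
theorem exists_abs_fderiv_inner_biotSavart2D_le (j : Fin 2) :
    ∃ C, 0 ≤ C ∧ ∀ x, |fderiv ℝ (fun y => ⟪biotSavart2D w y, y⟫) x (EuclideanSpace.single j 1)| ≤ C / (1 + ‖x‖) ^ 2 := by
  have hw1 : ContDiff ℝ 1 w := hw.of_le one_le_two
  obtain ⟨R, hRge, hs0, hs1, -⟩ := exists_support_radius hwc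
  have hdj : ContDiff ℝ 1 (fun z => fderiv ℝ w z (EuclideanSpace.single j 1)) := (hw.fderiv_right (m := 1) (by norm_num)).clm_apply contDiff_const
  have hdjc : Continuous (fun z => fderiv ℝ w z (EuclideanSpace.single j 1)) := hdj.continuous
  have hmom : ∀ k : Fin 2, ∫ y, fderiv ℝ w y (EuclideanSpace.single j 1) * y k = 0 := fun k => by
    rw [integral_fderiv_single_mul_coord hw1 hwc, hmass, mul_zero]
  have hgc : Continuous fun x => fderiv ℝ (fun y => ⟪biotSavart2D w y, y⟫) x (EuclideanSpace.single j 1) :=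
    ((contDiff_inner_biotSavart2D_id hwc hw).continuous_fderiv (by simp)).clm_apply continuous_const
  refine exists_bound_div_one_add_norm_pow hgc 2
    (A := 3 * R ^ 2 * (∫ y, |fderiv ℝ w y (EuclideanSpace.single j 1)|) + 3 * R * ∫ y, |w y|) (R₀ := 2 * R) fun x hx hx0 => ?_
  have hx' : 0 < ‖x‖ := norm_pos_iff.2 hx0
  rw [fderiv_inner_biotSavart2D_id hw1 hwc]
  have h1 := abs_inner_biotSavart2D_le_of_moments_eq_zero hdjc hRge (hs1 _) hmom hx0 hx
  have h2 := norm_biotSavart2D_le_of_integral_eq_zero hw.continuous hs0 hmass hx0 hx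
  have h3 : |⟪biotSavart2D w x, EuclideanSpace.single j (1:ℝ)⟫| ≤ ‖biotSavart2D w x‖ := by
    refine (abs_real_inner_le_norm _ _).trans ?_
    simp
  calc _ ≤ |⟪biotSavart2D (fun z => fderiv ℝ w z (EuclideanSpace.single j 1)) x, x⟫| + |⟪biotSavart2D w x, EuclideanSpace.single j (1:ℝ)⟫| := abs_add_le _ _
    _ ≤ 3 * R ^ 2 / ‖x‖ ^ 2 * (∫ y, |fderiv ℝ w y (EuclideanSpace.single j 1)|) + 3 * R / ‖x‖ ^ 2 * ∫ y, |w y| :=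
        add_le_add h1 (h3.trans h2)
    _ = _ := by field_simp

omit hmass in
/-- **`∂ᵢ∂ᵢ g = O(1/|x|²)`** (no mass condition needed). [folklore] -/
theorem exists_abs_fderiv_fderiv_inner_biotSavart2D_le (i : Fin 2) :
    ∃ C, 0 ≤ C ∧ ∀ x, |fderiv ℝ (fun y => fderiv ℝ (fun y => ⟪biotSavart2D w y, y⟫) y (EuclideanSpace.single i 1)) x (EuclideanSpace.single i 1)| ≤ C / (1 + ‖x‖) ^ 2 := by
  have hw1 : ContDiff ℝ 1 w := hw.of_le one_le_two
  obtain ⟨R, hRge, -, hs1, hs2⟩ := exists_support_radius hwc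
  have hdi : ContDiff ℝ 1 (fun z => fderiv ℝ w z (EuclideanSpace.single i 1)) := (hw.fderiv_right (m := 1) (by norm_num)).clm_apply contDiff_const
  have hdis : HasCompactSupport (fun z => fderiv ℝ w z (EuclideanSpace.single i 1)) := hwc.fderiv_apply (𝕜 := ℝ) _
  have hddc : Continuous (fun z => fderiv ℝ (fun z => fderiv ℝ w z (EuclideanSpace.single i 1)) z (EuclideanSpace.single i 1)) := continuous_fderiv_fderiv_of_contDiff_two hw _ _
  have hmom : ∀ k : Fin 2, ∫ y, fderiv ℝ (fun z => fderiv ℝ w z (EuclideanSpace.single i 1)) y (EuclideanSpace.single i 1) * y k = 0 := fun k => by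
    rw [integral_fderiv_single_mul_coord hdi hdis, integral_fderiv_apply_eq_zero hw1 hwc, mul_zero]
  have hmassi : ∫ y, fderiv ℝ w y (EuclideanSpace.single i 1) = 0 := integral_fderiv_apply_eq_zero hw1 hwc _
  have hgc : Continuous fun x => fderiv ℝ (fun y => fderiv ℝ (fun y => ⟪biotSavart2D w y, y⟫) y (EuclideanSpace.single i 1)) x (EuclideanSpace.single i 1) := by
    have h2 : ContDiff ℝ 2 (fun y => ⟪biotSavart2D w y, y⟫) := contDiff_inner_biotSavart2D_id hwc hw
    exact continuous_fderiv_fderiv_of_contDiff_two h2 _ _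
  refine exists_bound_div_one_add_norm_pow hgc 2
    (A := 3 * R ^ 2 * (∫ y, |fderiv ℝ (fun z => fderiv ℝ w z (EuclideanSpace.single i 1)) y (EuclideanSpace.single i 1)|) + 2 * (3 * R * ∫ y, |fderiv ℝ w y (EuclideanSpace.single i 1)|)) (R₀ := 2 * R)
    fun x hx hx0 => ?_
  have hx' : 0 < ‖x‖ := norm_pos_iff.2 hx0
  rw [fderiv_fderiv_inner_biotSavart2D_id hw hwc]
  have h1 := abs_inner_biotSavart2D_le_of_moments_eq_zero hddc hRge (hs2 _ _) hmom hx0 hx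
  have h2 := norm_biotSavart2D_le_of_integral_eq_zero hdi.continuous (hs1 _) hmassi hx0 hx
  have h3 : |biotSavart2D (fun z => fderiv ℝ w z (EuclideanSpace.single i 1)) x i| ≤ ‖biotSavart2D (fun z => fderiv ℝ w z (EuclideanSpace.single i 1)) x‖ := by
    simpa using PiLp.norm_apply_le (p := 2) (biotSavart2D (fun z => fderiv ℝ w z (EuclideanSpace.single i 1)) x) i
  calc _ ≤ |⟪biotSavart2D (fun z => fderiv ℝ (fun z => fderiv ℝ w z (EuclideanSpace.single i 1)) z (EuclideanSpace.single i 1)) x, x⟫| + |2 * biotSavart2D (fun z => fderiv ℝ w z (EuclideanSpace.single i 1)) x i| := abs_add_le _ _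
    _ = |⟪biotSavart2D (fun z => fderiv ℝ (fun z => fderiv ℝ w z (EuclideanSpace.single i 1)) z (EuclideanSpace.single i 1)) x, x⟫| + 2 * |biotSavart2D (fun z => fderiv ℝ w z (EuclideanSpace.single i 1)) x i| := by
        rw [abs_mul, abs_two]
    _ ≤ 3 * R ^ 2 / ‖x‖ ^ 2 * (∫ y, |fderiv ℝ (fun z => fderiv ℝ w z (EuclideanSpace.single i 1)) y (EuclideanSpace.single i 1)|) + 2 * (3 * R / ‖x‖ ^ 2 * ∫ y, |fderiv ℝ w y (EuclideanSpace.single i 1)|) :=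
        add_le_add h1 (by linarith [h3.trans h2])
    _ = _ := by field_simp

/-- **`∫ |∇g|² = ∫ g ∂_θw`** (`= −∫ g Δg`, no boundary terms thanks to the decay). [folklore] -/
theorem integral_sq_fderiv_inner_biotSavart2D_id :
    ∫ x, (fderiv ℝ (fun y => ⟪biotSavart2D w y, y⟫) x (EuclideanSpace.single 0 1)) ^ 2 + (fderiv ℝ (fun y => ⟪biotSavart2D w y, y⟫) x (EuclideanSpace.single 1 1)) ^ 2 =
      ∫ x, ⟪biotSavart2D w x, x⟫ * fderiv ℝ w x (perp x) := by
  have hw1 : ContDiff ℝ 1 w := hw.of_le one_le_two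
  have hg2 : ContDiff ℝ 2 (fun y => ⟪biotSavart2D w y, y⟫) := contDiff_inner_biotSavart2D_id hwc hw
  have hg1 : ContDiff ℝ 1 (fun y => ⟪biotSavart2D w y, y⟫) := hg2.of_le one_le_two
  obtain ⟨C₀, hC₀0, hC₀⟩ := exists_abs_inner_biotSavart2D_le hwc hw1
  have hgi : ∀ i : Fin 2, ContDiff ℝ 1 fun y => fderiv ℝ (fun y => ⟪biotSavart2D w y, y⟫) y (EuclideanSpace.single i 1) := fun i =>
    (hg2.fderiv_right (m := 1) (by norm_num)).clm_apply contDiff_const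
  -- integrability of the three products
  have I1 : ∀ i : Fin 2, Integrable fun x => fderiv ℝ (fun y => ⟪biotSavart2D w y, y⟫) x (EuclideanSpace.single i 1) * fderiv ℝ (fun y => ⟪biotSavart2D w y, y⟫) x (EuclideanSpace.single i 1) := by
    intro i
    obtain ⟨C, hC0, hC⟩ := exists_abs_fderiv_inner_biotSavart2D_le hw hwc hmass i
    refine integrable_of_abs_le_div_one_add_norm_pow ((hgi i).continuous.mul (hgi i).continuous).aestronglyMeasurable
      (C := C * C) (k := 4) (by norm_num) fun x => ?_
    rw [abs_mul]
    calc _ ≤ (C / (1 + ‖x‖) ^ 2) * (C / (1 + ‖x‖) ^ 2) := mul_le_mul (hC x) (hC x) (abs_nonneg _) (by positivity)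
      _ = C * C / (1 + ‖x‖) ^ 4 := by rw [div_mul_div_comm, ← pow_add]
  have I2 : ∀ i : Fin 2, Integrable fun x => ⟪biotSavart2D w x, x⟫ *
      fderiv ℝ (fun y => fderiv ℝ (fun y => ⟪biotSavart2D w y, y⟫) y (EuclideanSpace.single i 1)) x (EuclideanSpace.single i 1) := by
    intro i
    obtain ⟨C, hC0, hC⟩ := exists_abs_fderiv_fderiv_inner_biotSavart2D_le hw hwc i
    refine integrable_of_abs_le_div_one_add_norm_pow (hg2.continuous.mul
      (continuous_fderiv_fderiv_of_contDiff_two hg2 _ _)).aestronglyMeasurable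
      (C := C₀ * C) (k := 3) (by norm_num) fun x => ?_
    rw [abs_mul]
    calc _ ≤ (C₀ / (1 + ‖x‖)) * (C / (1 + ‖x‖) ^ 2) := mul_le_mul (hC₀ x) (hC x) (abs_nonneg _) (by positivity)
      _ = C₀ * C / (1 + ‖x‖) ^ 3 := by rw [div_mul_div_comm, ← pow_succ']
  have I3 : ∀ i : Fin 2, Integrable fun x => ⟪biotSavart2D w x, x⟫ * fderiv ℝ (fun y => ⟪biotSavart2D w y, y⟫) x (EuclideanSpace.single i 1) := by
    intro i
    obtain ⟨C, hC0, hC⟩ := exists_abs_fderiv_inner_biotSavart2D_le hw hwc hmass i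
    refine integrable_of_abs_le_div_one_add_norm_pow (hg2.continuous.mul (hgi i).continuous).aestronglyMeasurable
      (C := C₀ * C) (k := 3) (by norm_num) fun x => ?_
    rw [abs_mul]
    calc _ ≤ (C₀ / (1 + ‖x‖)) * (C / (1 + ‖x‖) ^ 2) := mul_le_mul (hC₀ x) (hC x) (abs_nonneg _) (by positivity)
      _ = C₀ * C / (1 + ‖x‖) ^ 3 := by rw [div_mul_div_comm, ← pow_succ']
  -- integration by parts, no boundary terms
  have hibp : ∀ i : Fin 2, ∫ x, fderiv ℝ (fun y => ⟪biotSavart2D w y, y⟫) x (EuclideanSpace.single i 1) * fderiv ℝ (fun y => ⟪biotSavart2D w y, y⟫) x (EuclideanSpace.single i 1) =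
      -∫ x, ⟪biotSavart2D w x, x⟫ * fderiv ℝ (fun y => fderiv ℝ (fun y => ⟪biotSavart2D w y, y⟫) y (EuclideanSpace.single i 1)) x (EuclideanSpace.single i 1) := by
    intro i
    have h := integral_mul_fderiv_eq_neg_fderiv_mul_of_integrable (μ := volume) (f := (fun y => ⟪biotSavart2D w y, y⟫))
      (g := fun y => fderiv ℝ (fun y => ⟪biotSavart2D w y, y⟫) y (EuclideanSpace.single i 1)) (v := (EuclideanSpace.single i 1)) (I1 i) (I2 i) (I3 i)
      (fun x _ => (hg1.differentiable one_ne_zero) x) (fun x _ => ((hgi i).differentiable one_ne_zero) x)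
    linarith
  have hΔ : ∀ x, fderiv ℝ (fun y => fderiv ℝ (fun y => ⟪biotSavart2D w y, y⟫) y (EuclideanSpace.single 0 1)) x (EuclideanSpace.single 0 1) +
      fderiv ℝ (fun y => fderiv ℝ (fun y => ⟪biotSavart2D w y, y⟫) y (EuclideanSpace.single 1 1)) x (EuclideanSpace.single 1 1) = -fderiv ℝ w x (perp x) := by
    intro x
    rw [← laplacian_eq_fin_two' hg2, laplacian_inner_biotSavart2D_id hw hwc]
  rw [integral_add ((I1 0).congr (Eventually.of_forall fun x => by beta_reduce; ring))
    ((I1 1).congr (Eventually.of_forall fun x => by beta_reduce; ring))]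
  have e0 : ∫ x, (fderiv ℝ (fun y => ⟪biotSavart2D w y, y⟫) x (EuclideanSpace.single 0 1)) ^ 2 = ∫ x, fderiv ℝ (fun y => ⟪biotSavart2D w y, y⟫) x (EuclideanSpace.single 0 1) * fderiv ℝ (fun y => ⟪biotSavart2D w y, y⟫) x (EuclideanSpace.single 0 1) :=
    integral_congr_ae (Eventually.of_forall fun x => by beta_reduce; ring)
  have e1 : ∫ x, (fderiv ℝ (fun y => ⟪biotSavart2D w y, y⟫) x (EuclideanSpace.single 1 1)) ^ 2 = ∫ x, fderiv ℝ (fun y => ⟪biotSavart2D w y, y⟫) x (EuclideanSpace.single 1 1) * fderiv ℝ (fun y => ⟪biotSavart2D w y, y⟫) x (EuclideanSpace.single 1 1) :=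
    integral_congr_ae (Eventually.of_forall fun x => by beta_reduce; ring)
  rw [e0, e1, hibp 0, hibp 1, ← neg_add, ← integral_add (I2 0) (I2 1), ← integral_neg]
  refine integral_congr_ae (Eventually.of_forall fun x => ?_)
  beta_reduce
  rw [← mul_add, hΔ x]
  ring

end DecayG

/-! ### The key one-variable bounds -/

/-- **`Φ(r) r² ≤ 16/5`**: with `t = r²/4`, `Φ r² = 4t²/(e^t − 1)` and `5t² ≤ 4(e^t − 1)`. [folklore] -/
theorem kerWeight_mul_sq_le (r : ℝ) : kerWeight r * r ^ 2 ≤ 16 / 5 := by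
  rcases eq_or_ne r 0 with hr | hr
  · subst hr; norm_num
  have ht : 0 < r ^ 2 / 4 := by positivity
  have hφ := burgersPhi_of_ne_zero ht.ne'
  have hE := Literature.NumberTheory.Sieve.JurkatRichert.cubic_le_exp ht.le
  have hE0 : 0 < Real.exp (r ^ 2 / 4) := Real.exp_pos _
  have hneg : Real.exp (-(r ^ 2 / 4)) = (Real.exp (r ^ 2 / 4))⁻¹ := Real.exp_neg _
  have h1 : 1 < Real.exp (r ^ 2 / 4) := by linarith [pow_pos ht 2, pow_pos ht 3]
  rw [kerWeight, hφ, hneg]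
  rw [show (Real.exp (r ^ 2 / 4))⁻¹ / ((1 - (Real.exp (r ^ 2 / 4))⁻¹) / (r ^ 2 / 4)) * r ^ 2 =
    (r ^ 2 / 4 * r ^ 2) / (Real.exp (r ^ 2 / 4) - 1) by field_simp]
  rw [div_le_div_iff₀ (by linarith) (by norm_num)]
  nlinarith [sq_nonneg (r ^ 2 / 4 - 9 / 4), ht]

/-- **Weighted Young inequality** with the weight `h = 4/r² − Φ ≥ 4/(5r²)`:
`|g| |u| ≤ ½ (4/r² − Φ) g² + (5/8) r² u²`. [folklore] -/
theorem abs_mul_abs_le_kerWeight_young {r Φ : ℝ} (hr : 0 < r) (hΦ : Φ * r ^ 2 ≤ 16 / 5) (g u : ℝ) :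
    |g| * |u| ≤ 1 / 2 * (4 / r ^ 2 - Φ) * g ^ 2 + 5 / 8 * r ^ 2 * u ^ 2 := by
  have hr2 : 0 < r ^ 2 := by positivity
  set H := 4 / r ^ 2 - Φ with hH
  have hHr : 4 / 5 ≤ r ^ 2 * H := by
    rw [hH, mul_sub, mul_div_cancel₀ _ hr2.ne']
    linarith [mul_comm Φ (r ^ 2)]
  have hH0 : 0 < H := by
    by_contra h
    have h' : H ≤ 0 := le_of_not_gt h
    nlinarith
  have key : |g| * |u| * (2 * H) ≤ H ^ 2 * g ^ 2 + u ^ 2 := by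
    nlinarith [sq_nonneg (H * |g| - |u|), sq_abs g, sq_abs u]
  have k2 : |g| * |u| ≤ (H ^ 2 * g ^ 2 + u ^ 2) / (2 * H) := by
    rw [le_div_iff₀ (by positivity)]; exact key
  have k3 : (H ^ 2 * g ^ 2 + u ^ 2) / (2 * H) = 1 / 2 * H * g ^ 2 + u ^ 2 / (2 * H) := by
    field_simp
  have k4 : u ^ 2 / (2 * H) ≤ 5 / 8 * r ^ 2 * u ^ 2 := by
    rw [div_le_iff₀ (by positivity)]
    have hu : 0 ≤ u ^ 2 := sq_nonneg u
    nlinarith [mul_le_mul_of_nonneg_left hHr hu]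
  linarith

/-! ### The positivity estimate in the even sector -/

section Main

variable {w : EuclideanSpace ℝ (Fin 2) → ℝ} (hw : ContDiff ℝ 2 w) (hwc : HasCompactSupport w)
include hw hwc

omit hw hwc in
/-- `∂_θg = −x₁∂₀g + x₀∂₁g`, hence `(∂_θg)²/r² ≤ (∂₀g)² + (∂₁g)²`. [folklore] -/
theorem inv_normSq_mul_sq_fderiv_perp_le (h : EuclideanSpace ℝ (Fin 2) → ℝ) (x : EuclideanSpace ℝ (Fin 2)) :
    (‖x‖ ^ 2)⁻¹ * (fderiv ℝ h x (perp x)) ^ 2 ≤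
      (fderiv ℝ h x (EuclideanSpace.single 0 1)) ^ 2 + (fderiv ℝ h x (EuclideanSpace.single 1 1)) ^ 2 := by
  rcases eq_or_ne x 0 with hx | hx
  · subst hx; simp; positivity
  have hn : ‖x‖ ^ 2 = x 0 * x 0 + x 1 * x 1 := by rw [← real_inner_self_eq_norm_sq, inner_fin_two]
  have hn0 : 0 < ‖x‖ ^ 2 := by positivity
  rw [fderiv_perp_eq_coord, inv_mul_le_iff₀ hn0, hn]
  nlinarith [sq_nonneg (x 0 * fderiv ℝ h x (EuclideanSpace.single 0 1) + x 1 * fderiv ℝ h x (EuclideanSpace.single 1 1))]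

/-- `|x|² (∂_θu)²` is integrable (`u = w + Φψ` and `Du` are Gaussian). [folklore] -/
theorem integrable_normSq_mul_sq_angular_corrected :
    Integrable fun x => ‖x‖ ^ 2 * (fderiv ℝ (fun y => w y + kerWeight ‖y‖ * ∫ z, w z * ((2 * π)⁻¹ * Real.log ‖y - z‖)) x (perp x)) ^ 2 := by
  obtain ⟨Cu, hCu0, hCu⟩ := exists_corrected_gauss_bound hw hwc
  have hu1 := contDiff_one_corrected hw hwc
  have hc : Continuous fun x => ‖x‖ ^ 2 * (fderiv ℝ (fun y => w y + kerWeight ‖y‖ * ∫ z, w z * ((2 * π)⁻¹ * Real.log ‖y - z‖)) x (perp x)) ^ 2 :=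
    (continuous_norm.pow 2).mul (((hu1.continuous_fderiv one_ne_zero).clm_apply continuous_perp).pow 2)
  refine integrable_of_norm_le_poly_mul_gauss (C := Cu ^ 2) (N := 16) hc.aestronglyMeasurable
    (by norm_num : (-(1/2) : ℝ) < 0) fun x => ?_
  obtain ⟨-, hu'⟩ := hCu x
  have hθ : |fderiv ℝ (fun y => w y + kerWeight ‖y‖ * ∫ z, w z * ((2 * π)⁻¹ * Real.log ‖y - z‖)) x (perp x)| ≤ Cu * (1 + ‖x‖) ^ 6 * Real.exp (-(‖x‖ ^ 2 / 4)) * (1 + ‖x‖) := by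
    rw [← Real.norm_eq_abs]
    refine (ContinuousLinearMap.le_opNorm _ _).trans ?_
    rw [norm_perp]
    exact mul_le_mul hu' (by linarith [norm_nonneg x]) (norm_nonneg _) (by positivity)
  have hθ2 : (fderiv ℝ (fun y => w y + kerWeight ‖y‖ * ∫ z, w z * ((2 * π)⁻¹ * Real.log ‖y - z‖)) x (perp x)) ^ 2 ≤ (Cu * (1 + ‖x‖) ^ 6 * Real.exp (-(‖x‖ ^ 2 / 4)) * (1 + ‖x‖)) ^ 2 := by
    rw [← sq_abs (fderiv ℝ (fun y => w y + kerWeight ‖y‖ * ∫ z, w z * ((2 * π)⁻¹ * Real.log ‖y - z‖)) x (perp x))]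
    exact pow_le_pow_left₀ (abs_nonneg _) hθ 2
  have hx2 : ‖x‖ ^ 2 ≤ (1 + ‖x‖) ^ 2 := pow_le_pow_left₀ (norm_nonneg _) (by linarith [norm_nonneg x]) 2
  have hexp : Real.exp (-(‖x‖ ^ 2 / 4)) ^ 2 = Real.exp (-(1/2) * ‖x‖ ^ 2) := by
    rw [← Real.exp_nat_mul]; ring_nf
  rw [Real.norm_of_nonneg (by positivity)]
  calc ‖x‖ ^ 2 * (fderiv ℝ (fun y => w y + kerWeight ‖y‖ * ∫ z, w z * ((2 * π)⁻¹ * Real.log ‖y - z‖)) x (perp x)) ^ 2 ≤ (1 + ‖x‖) ^ 2 * (Cu * (1 + ‖x‖) ^ 6 * Real.exp (-(‖x‖ ^ 2 / 4)) * (1 + ‖x‖)) ^ 2 :=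
        mul_le_mul hx2 hθ2 (sq_nonneg _) (by positivity)
    _ = Cu ^ 2 * (1 + ‖x‖) ^ 16 * Real.exp (-(‖x‖ ^ 2 / 4)) ^ 2 := by ring
    _ = _ := by rw [hexp]

/-- `Φ g²` and `|g| |∂_θu|` are integrable. [folklore] -/
theorem integrable_kerWeight_mul_sq_inner_biotSavart2D :
    Integrable (fun x => kerWeight ‖x‖ * ⟪biotSavart2D w x, x⟫ ^ 2) ∧
      Integrable (fun x => |⟪biotSavart2D w x, x⟫| * |fderiv ℝ (fun y => w y + kerWeight ‖y‖ * ∫ z, w z * ((2 * π)⁻¹ * Real.log ‖y - z‖)) x (perp x)|) := by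
  have hw1 : ContDiff ℝ 1 w := hw.of_le one_le_two
  obtain ⟨C₀, hC₀0, hC₀⟩ := exists_abs_inner_biotSavart2D_le hwc hw1
  obtain ⟨Cu, hCu0, hCu⟩ := exists_corrected_gauss_bound hw hwc
  obtain ⟨CΦ, -, hΦ⟩ := exists_kerWeight_norm_gauss_bound
  have hu1 := contDiff_one_corrected hw hwc
  have hg : Continuous fun x => ⟪biotSavart2D w x, x⟫ := (contDiff_inner_biotSavart2D_id hwc hw1).continuous
  have hg0 : ∀ x, |⟪biotSavart2D w x, x⟫| ≤ C₀ := fun x => (hC₀ x).trans (div_le_self hC₀0 (by linarith [norm_nonneg x]))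
  constructor
  · have hc : Continuous fun x => kerWeight ‖x‖ * ⟪biotSavart2D w x, x⟫ ^ 2 :=
      (continuous_kerWeight.comp continuous_norm).mul (hg.pow 2)
    refine integrable_of_norm_le_poly_mul_gauss (C := C₀ ^ 2) (N := 2) hc.aestronglyMeasurable
      (by norm_num : (-(1/4) : ℝ) < 0) fun x => ?_
    have hg2 : ⟪biotSavart2D w x, x⟫ ^ 2 ≤ C₀ ^ 2 := by
      rw [← sq_abs]; exact pow_le_pow_left₀ (abs_nonneg _) (hg0 x) 2
    rw [Real.norm_of_nonneg (mul_nonneg (kerWeight_pos _).le (sq_nonneg _))]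
    calc kerWeight ‖x‖ * ⟪biotSavart2D w x, x⟫ ^ 2 ≤ ((1 + ‖x‖) ^ 2 * Real.exp (-(‖x‖ ^ 2 / 4))) * C₀ ^ 2 :=
          mul_le_mul (hΦ x).1 hg2 (sq_nonneg _) (by positivity)
      _ = _ := by ring_nf
  · have hc : Continuous fun x => |⟪biotSavart2D w x, x⟫| * |fderiv ℝ (fun y => w y + kerWeight ‖y‖ * ∫ z, w z * ((2 * π)⁻¹ * Real.log ‖y - z‖)) x (perp x)| :=
      hg.abs.mul ((hu1.continuous_fderiv one_ne_zero).clm_apply continuous_perp).abs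
    refine integrable_of_norm_le_poly_mul_gauss (C := C₀ * Cu) (N := 7) hc.aestronglyMeasurable
      (by norm_num : (-(1/4) : ℝ) < 0) fun x => ?_
    obtain ⟨-, hu'⟩ := hCu x
    have hθ : |fderiv ℝ (fun y => w y + kerWeight ‖y‖ * ∫ z, w z * ((2 * π)⁻¹ * Real.log ‖y - z‖)) x (perp x)| ≤ Cu * (1 + ‖x‖) ^ 6 * Real.exp (-(‖x‖ ^ 2 / 4)) * (1 + ‖x‖) := by
      rw [← Real.norm_eq_abs]
      refine (ContinuousLinearMap.le_opNorm _ _).trans ?_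
      rw [norm_perp]
      exact mul_le_mul hu' (by linarith [norm_nonneg x]) (norm_nonneg _) (by positivity)
    rw [Real.norm_of_nonneg (by positivity)]
    calc |⟪biotSavart2D w x, x⟫| * |fderiv ℝ (fun y => w y + kerWeight ‖y‖ * ∫ z, w z * ((2 * π)⁻¹ * Real.log ‖y - z‖)) x (perp x)| ≤ C₀ * (Cu * (1 + ‖x‖) ^ 6 * Real.exp (-(‖x‖ ^ 2 / 4)) * (1 + ‖x‖)) :=
          mul_le_mul (hg0 x) hθ (abs_nonneg _) hC₀0
      _ = _ := by ring_nf

/-- `g²/|x|²` is integrable (bounded near `0` since `|g| ≤ ‖v‖ |x|`, `O(|x|⁻⁴)` at infinity).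
[folklore] -/
theorem integrable_inv_normSq_mul_sq_inner_biotSavart2D :
    Integrable fun x => (‖x‖ ^ 2)⁻¹ * ⟪biotSavart2D w x, x⟫ ^ 2 := by
  have hw1 : ContDiff ℝ 1 w := hw.of_le one_le_two
  obtain ⟨C₀, hC₀0, hC₀⟩ := exists_abs_inner_biotSavart2D_le hwc hw1
  obtain ⟨V, hV0, hV⟩ := exists_logPotential_biotSavart_bound hw1 hwc
  have hg : Continuous fun x => ⟪biotSavart2D w x, x⟫ := (contDiff_inner_biotSavart2D_id hwc hw1).continuous
  have hmeas : AEStronglyMeasurable (fun x => (‖x‖ ^ 2)⁻¹ * ⟪biotSavart2D w x, x⟫ ^ 2) volume :=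
    ((measurable_norm.pow_const 2).inv.mul (hg.measurable.pow_const 2)).aestronglyMeasurable
  refine integrable_of_abs_le_div_one_add_norm_pow hmeas (C := 16 * V ^ 2 + 4 * C₀ ^ 2) (k := 4)
    (by norm_num) fun x => ?_
  have hpos : 0 < 1 + ‖x‖ := by positivity
  rw [abs_of_nonneg (by positivity), le_div_iff₀ (by positivity)]
  rcases eq_or_ne x 0 with hx | hx
  · subst hx; simp; positivity
  have hn : 0 < ‖x‖ := norm_pos_iff.2 hx
  -- `g² ≤ V² |x|²` and `g² ≤ C₀²/(1+|x|)²`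
  have hgv : |⟪biotSavart2D w x, x⟫| ≤ V * ‖x‖ := (abs_real_inner_le_norm _ _).trans
    (mul_le_mul_of_nonneg_right (hV x).2.1 (norm_nonneg _))
  have hg1 : ⟪biotSavart2D w x, x⟫ ^ 2 ≤ (V * ‖x‖) ^ 2 := by rw [← sq_abs]; exact pow_le_pow_left₀ (abs_nonneg _) hgv 2
  have hg2 : ⟪biotSavart2D w x, x⟫ ^ 2 ≤ (C₀ / (1 + ‖x‖)) ^ 2 := by
    rw [← sq_abs]; exact pow_le_pow_left₀ (abs_nonneg _) (hC₀ x) 2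
  rcases le_or_gt ‖x‖ 1 with h1 | h1
  · -- near the origin
    have e1 : (‖x‖ ^ 2)⁻¹ * ⟪biotSavart2D w x, x⟫ ^ 2 ≤ V ^ 2 := by
      rw [inv_mul_le_iff₀ (by positivity)]
      calc ⟪biotSavart2D w x, x⟫ ^ 2 ≤ (V * ‖x‖) ^ 2 := hg1
        _ = ‖x‖ ^ 2 * V ^ 2 := by ring
    have e2 : (1 + ‖x‖) ^ 4 ≤ 16 := by
      have : 1 + ‖x‖ ≤ 2 := by linarith
      calc (1 + ‖x‖) ^ 4 ≤ (2:ℝ) ^ 4 := pow_le_pow_left₀ hpos.le this 4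
        _ = 16 := by norm_num
    calc (‖x‖ ^ 2)⁻¹ * ⟪biotSavart2D w x, x⟫ ^ 2 * (1 + ‖x‖) ^ 4 ≤ V ^ 2 * 16 :=
          mul_le_mul e1 e2 (by positivity) (sq_nonneg _)
      _ ≤ _ := by nlinarith [sq_nonneg C₀]
  · -- far away
    have e1 : (‖x‖ ^ 2)⁻¹ * ⟪biotSavart2D w x, x⟫ ^ 2 * (1 + ‖x‖) ^ 4 ≤
        (‖x‖ ^ 2)⁻¹ * (C₀ / (1 + ‖x‖)) ^ 2 * (1 + ‖x‖) ^ 4 := by gcongr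
    have e2 : (‖x‖ ^ 2)⁻¹ * (C₀ / (1 + ‖x‖)) ^ 2 * (1 + ‖x‖) ^ 4 = C₀ ^ 2 * ((1 + ‖x‖) ^ 2 / ‖x‖ ^ 2) := by
      field_simp
    have e3 : (1 + ‖x‖) ^ 2 / ‖x‖ ^ 2 ≤ 4 := by
      rw [div_le_iff₀ (by positivity)]; nlinarith
    calc (‖x‖ ^ 2)⁻¹ * ⟪biotSavart2D w x, x⟫ ^ 2 * (1 + ‖x‖) ^ 4 ≤ C₀ ^ 2 * ((1 + ‖x‖) ^ 2 / ‖x‖ ^ 2) := e1.trans_eq e2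
      _ ≤ C₀ ^ 2 * 4 := mul_le_mul_of_nonneg_left e3 (sq_nonneg _)
      _ ≤ _ := by nlinarith [sq_nonneg V]

/-- **Positivity in the even sector.** For an even `w ∈ C²_c(ℝ²)` with `∫ w = 0`, `v = K ∗ w`,
`u = w + Φ (N ∗ w)`:

  `∫ (4/|x|² − Φ(|x|)) ⟪v, x⟫² ≤ (5/4) ∫ |x|² (∂_θu)²`,

where `4/|x|² − Φ ≥ 4/(5|x|²) > 0`. Proof: `g = ⟪v,x⟫` is even with zero circular means, so
`4∫ g²/|x|² ≤ ∫ (∂_θg)²/|x|² ≤ ∫ |∇g|² = ∫ g ∂_θw = ∫ g ∂_θu + ∫ Φ g²` (`∂_θw = ∂_θu + Φg`), and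
the weighted Young inequality closes the estimate. This is the quantitative form of the
positivity of `−(Δ_θ-part)` on the modes `|n| ≥ 2` behind Maekawa's Proposition 4.3.
[cite: Maekawa2009b, §4 Prop. 4.3 and Lemma 4.1] -/
theorem even_sector_positivity (heven : ∀ x, w (-x) = w x) (hmass : ∫ x, w x = 0) :
    ∫ x, (4 / ‖x‖ ^ 2 - kerWeight ‖x‖) * ⟪biotSavart2D w x, x⟫ ^ 2 ≤ 5 / 4 * ∫ x, ‖x‖ ^ 2 * (fderiv ℝ (fun y => w y + kerWeight ‖y‖ * ∫ z, w z * ((2 * π)⁻¹ * Real.log ‖y - z‖)) x (perp x)) ^ 2 := by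
  have hw1 : ContDiff ℝ 1 w := hw.of_le one_le_two
  have hg2 : ContDiff ℝ 2 (fun y => ⟪biotSavart2D w y, y⟫) := contDiff_inner_biotSavart2D_id hwc hw
  have hg1 : ContDiff ℝ 1 (fun y => ⟪biotSavart2D w y, y⟫) := hg2.of_le one_le_two
  -- integrability
  have iR := integrable_inv_normSq_mul_sq_inner_biotSavart2D hw hwc
  obtain ⟨iΦ, igu⟩ := integrable_kerWeight_mul_sq_inner_biotSavart2D hw hwc
  have iU := integrable_normSq_mul_sq_angular_corrected hw hwc
  have hid := integral_sq_fderiv_inner_biotSavart2D_id hw hwc hmass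
  have I1 : ∀ i : Fin 2, Integrable fun x => (fderiv ℝ (fun y => ⟪biotSavart2D w y, y⟫) x (EuclideanSpace.single i 1)) ^ 2 := by
    intro i
    obtain ⟨C, hC0, hC⟩ := exists_abs_fderiv_inner_biotSavart2D_le hw hwc hmass i
    have hgi : ContDiff ℝ 1 fun y => fderiv ℝ (fun y => ⟪biotSavart2D w y, y⟫) y (EuclideanSpace.single i 1) :=
      (hg2.fderiv_right (m := 1) (by norm_num)).clm_apply contDiff_const
    refine integrable_of_abs_le_div_one_add_norm_pow (hgi.continuous.pow 2).aestronglyMeasurable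
      (C := C * C) (k := 4) (by norm_num) fun x => ?_
    rw [abs_of_nonneg (sq_nonneg _), sq, ← abs_mul_abs_self]
    calc _ ≤ (C / (1 + ‖x‖) ^ 2) * (C / (1 + ‖x‖) ^ 2) := mul_le_mul (hC x) (hC x) (abs_nonneg _) (by positivity)
      _ = C * C / (1 + ‖x‖) ^ 4 := by rw [div_mul_div_comm, ← pow_add]
  have I01 : Integrable fun x => (fderiv ℝ (fun y => ⟪biotSavart2D w y, y⟫) x (EuclideanSpace.single 0 1)) ^ 2 + (fderiv ℝ (fun y => ⟪biotSavart2D w y, y⟫) x (EuclideanSpace.single 1 1)) ^ 2 := (I1 0).add (I1 1)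
  -- Wirtinger in the even sector with weight `1/r²`
  have iθ : Integrable fun x => (‖x‖ ^ 2)⁻¹ * (fderiv ℝ (fun y => ⟪biotSavart2D w y, y⟫) x (perp x)) ^ 2 :=
    I01.mono' ((measurable_norm.pow_const 2).inv.mul (((hg1.continuous_fderiv one_ne_zero).clm_apply
      continuous_perp).measurable.pow_const 2)).aestronglyMeasurable (Eventually.of_forall fun x => by
        rw [Real.norm_of_nonneg (by positivity)]; exact inv_normSq_mul_sq_fderiv_perp_le (fun y => ⟪biotSavart2D w y, y⟫) x)
  have hW := planar_wirtinger_even (ρ := fun r => (r ^ 2)⁻¹) hg1 (fun x => inner_biotSavart2D_neg_of_even heven x)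
    (fun r _ => integral_inner_biotSavart2D_circlePt hw1 hwc r) (fun r _ => by positivity) iR iθ
  have hθ : ∫ x, (‖x‖ ^ 2)⁻¹ * (fderiv ℝ (fun y => ⟪biotSavart2D w y, y⟫) x (perp x)) ^ 2 ≤
      ∫ x, (fderiv ℝ (fun y => ⟪biotSavart2D w y, y⟫) x (EuclideanSpace.single 0 1)) ^ 2 + (fderiv ℝ (fun y => ⟪biotSavart2D w y, y⟫) x (EuclideanSpace.single 1 1)) ^ 2 :=
    integral_mono iθ I01 fun x => inv_normSq_mul_sq_fderiv_perp_le (fun y => ⟪biotSavart2D w y, y⟫) x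
  -- `∫ g ∂_θw = ∫ g ∂_θu + ∫ Φ g²`
  have hsplit : ∫ x, ⟪biotSavart2D w x, x⟫ * fderiv ℝ w x (perp x) = (∫ x, ⟪biotSavart2D w x, x⟫ * fderiv ℝ (fun y => w y + kerWeight ‖y‖ * ∫ z, w z * ((2 * π)⁻¹ * Real.log ‖y - z‖)) x (perp x)) + ∫ x, kerWeight ‖x‖ * ⟪biotSavart2D w x, x⟫ ^ 2 := by
    have igu' : Integrable fun x => ⟪biotSavart2D w x, x⟫ * fderiv ℝ (fun y => w y + kerWeight ‖y‖ * ∫ z, w z * ((2 * π)⁻¹ * Real.log ‖y - z‖)) x (perp x) := by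
      refine igu.mono' ?_ (Eventually.of_forall fun x => by rw [Real.norm_eq_abs, abs_mul])
      exact (hg1.continuous.mul (((contDiff_one_corrected hw hwc).continuous_fderiv one_ne_zero).clm_apply
        continuous_perp)).aestronglyMeasurable
    rw [← integral_add igu' iΦ]
    refine integral_congr_ae (Eventually.of_forall fun x => ?_)
    beta_reduce
    rw [fderiv_corrected_perp_eq hw hwc x]
    ring
  -- the Young step
  have hY : ∫ x, ⟪biotSavart2D w x, x⟫ * fderiv ℝ (fun y => w y + kerWeight ‖y‖ * ∫ z, w z * ((2 * π)⁻¹ * Real.log ‖y - z‖)) x (perp x) ≤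
      ∫ x, 1 / 2 * ((4 / ‖x‖ ^ 2 - kerWeight ‖x‖) * ⟪biotSavart2D w x, x⟫ ^ 2) + 5 / 8 * (‖x‖ ^ 2 * (fderiv ℝ (fun y => w y + kerWeight ‖y‖ * ∫ z, w z * ((2 * π)⁻¹ * Real.log ‖y - z‖)) x (perp x)) ^ 2) := by
    have iL : Integrable fun x => (4 / ‖x‖ ^ 2 - kerWeight ‖x‖) * ⟪biotSavart2D w x, x⟫ ^ 2 := by
      have : Integrable fun x => 4 * ((‖x‖ ^ 2)⁻¹ * ⟪biotSavart2D w x, x⟫ ^ 2) - kerWeight ‖x‖ * ⟪biotSavart2D w x, x⟫ ^ 2 :=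
        (iR.const_mul 4).sub iΦ
      exact this.congr (Eventually.of_forall fun x => by beta_reduce; ring)
    refine (integral_mono (by
      refine igu.mono' ?_ (Eventually.of_forall fun x => by rw [Real.norm_eq_abs, abs_mul])
      exact (hg1.continuous.mul (((contDiff_one_corrected hw hwc).continuous_fderiv one_ne_zero).clm_apply
        continuous_perp)).aestronglyMeasurable) ((iL.const_mul _).add (iU.const_mul _)) fun x => ?_)
    beta_reduce
    rcases eq_or_ne x 0 with hx | hx
    · subst hx
      simp only [norm_zero, perp_zero, map_zero, mul_zero, ne_eq, OfNat.ofNat_ne_zero,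
        not_false_eq_true, zero_pow, le_refl, inner_zero_right, add_zero]
    · have h := abs_mul_abs_le_kerWeight_young (norm_pos_iff.2 hx) (kerWeight_mul_sq_le ‖x‖) (⟪biotSavart2D w x, x⟫) (fderiv ℝ (fun y => w y + kerWeight ‖y‖ * ∫ z, w z * ((2 * π)⁻¹ * Real.log ‖y - z‖)) x (perp x))
      refine (le_abs_self _).trans ((abs_mul _ _).le.trans (h.trans (le_of_eq ?_)))
      ring
  have iL : Integrable fun x => (4 / ‖x‖ ^ 2 - kerWeight ‖x‖) * ⟪biotSavart2D w x, x⟫ ^ 2 := by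
    have : Integrable fun x => 4 * ((‖x‖ ^ 2)⁻¹ * ⟪biotSavart2D w x, x⟫ ^ 2) - kerWeight ‖x‖ * ⟪biotSavart2D w x, x⟫ ^ 2 :=
      (iR.const_mul 4).sub iΦ
    exact this.congr (Eventually.of_forall fun x => by beta_reduce; ring)
  rw [integral_add (iL.const_mul _) (iU.const_mul _), integral_const_mul, integral_const_mul] at hY
  have hT : ∫ x, (4 / ‖x‖ ^ 2 - kerWeight ‖x‖) * ⟪biotSavart2D w x, x⟫ ^ 2 =
      4 * (∫ x, (‖x‖ ^ 2)⁻¹ * ⟪biotSavart2D w x, x⟫ ^ 2) - ∫ x, kerWeight ‖x‖ * ⟪biotSavart2D w x, x⟫ ^ 2 := by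
    rw [← integral_const_mul, ← integral_sub (iR.const_mul 4) iΦ]
    exact integral_congr_ae (Eventually.of_forall fun x => by beta_reduce; ring)
  -- combine: `T = 4∫g²/r² − ∫Φg² ≤ ∫ g∂_θu ≤ T/2 + (5/8) ∫ r²(∂_θu)²`
  have hchain : 4 * (∫ x, (‖x‖ ^ 2)⁻¹ * ⟪biotSavart2D w x, x⟫ ^ 2) - (∫ x, kerWeight ‖x‖ * ⟪biotSavart2D w x, x⟫ ^ 2) ≤ ∫ x, ⟪biotSavart2D w x, x⟫ * fderiv ℝ (fun y => w y + kerWeight ‖y‖ * ∫ z, w z * ((2 * π)⁻¹ * Real.log ‖y - z‖)) x (perp x) := by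
    linarith [hW, hθ, hid, hsplit]
  rw [hT]
  rw [hT] at hY
  linarith

end Main

/-! ### Conversion to the weighted form used at large circulation -/

/-- `φ(t) ≥ 1/(1+t)` for `t ≥ 0` (private copy of the statement in `KerWeightBounds`, which is
private there). [folklore] -/
private theorem one_div_one_add_le_burgersPhi' {t : ℝ} (ht : 0 ≤ t) : 1 / (1 + t) ≤ burgersPhi t := by
  rcases ht.eq_or_lt with rfl | ht'
  · simp
  · rw [burgersPhi_of_ne_zero ht'.ne', div_le_div_iff₀ (by linarith) ht']
    have h1 : 1 + t ≤ Real.exp t := by linarith [Real.add_one_le_exp t]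
    have h2 : Real.exp (-t) * Real.exp t = 1 := by rw [← Real.exp_add]; simp
    nlinarith [Real.exp_pos (-t), Real.exp_pos t]

/-- **The weight comparison `pχΩΦ² ≤ (1/π)(4/(5|x|²))`**
(`0 ≤ λ`: `p = e^{(1−λ)|x|²/4} ≤ e^{|x|²/4}`, `Ω ≤ (8π)⁻¹`, `Φ ≤ (1+|x|)² e^{−|x|²/4}`, `Φ|x|² ≤ 16/5`).
[folklore] -/
theorem gaussWeightChi_omega_kerWeight_sq_le {lam : ℝ} (hlam0 : 0 ≤ lam)
    {x : EuclideanSpace ℝ (Fin 2)} (hx : x ≠ 0) :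
    (Real.exp ((1 - lam) / 4 * ‖x‖ ^ 2) * (1 + ‖x‖ ^ 2)⁻¹) * (gaussVortexProfile x / (2 * kerWeight ‖x‖)) * kerWeight ‖x‖ ^ 2 ≤ π⁻¹ * (4 / (5 * ‖x‖ ^ 2)) := by
  have hr : 0 < ‖x‖ := norm_pos_iff.2 hx
  obtain ⟨CΦ, -, hΦ⟩ := exists_kerWeight_norm_gauss_bound
  have hΦ1 := (hΦ x).1
  have hΦ2 := kerWeight_mul_sq_le ‖x‖
  have hΦ0 := kerWeight_pos ‖x‖
  obtain ⟨hΩ0, hΩ⟩ := gaussVortexProfile_div_two_mul_kerWeight_le x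
  have hp : Real.exp ((1 - lam) / 4 * ‖x‖ ^ 2) ≤ Real.exp (‖x‖ ^ 2 / 4) := Real.exp_le_exp.2 (by nlinarith [sq_nonneg ‖x‖])
  have hee : Real.exp (‖x‖ ^ 2 / 4) * Real.exp (-(‖x‖ ^ 2 / 4)) = 1 := by
    rw [← Real.exp_add]; simp
  have hχ : (1 + ‖x‖) ^ 2 * (1 + ‖x‖ ^ 2)⁻¹ ≤ 2 := by
    rw [← div_eq_mul_inv, div_le_iff₀ (by positivity)]; nlinarith [sq_nonneg (1 - ‖x‖)]
  calc (Real.exp ((1 - lam) / 4 * ‖x‖ ^ 2) * (1 + ‖x‖ ^ 2)⁻¹) * (gaussVortexProfile x / (2 * kerWeight ‖x‖)) * kerWeight ‖x‖ ^ 2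
      = Real.exp ((1 - lam) / 4 * ‖x‖ ^ 2) * (1 + ‖x‖ ^ 2)⁻¹ * (gaussVortexProfile x / (2 * kerWeight ‖x‖)) * kerWeight ‖x‖ * (kerWeight ‖x‖ * ‖x‖ ^ 2) * (‖x‖ ^ 2)⁻¹ := by
        field_simp
    _ ≤ Real.exp (‖x‖ ^ 2 / 4) * (1 + ‖x‖ ^ 2)⁻¹ * (8 * π)⁻¹ * ((1 + ‖x‖) ^ 2 * Real.exp (-(‖x‖ ^ 2 / 4))) *
        (16 / 5) * (‖x‖ ^ 2)⁻¹ := by gcongr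
    _ = (8 * π)⁻¹ * (16 / 5) * ((1 + ‖x‖) ^ 2 * (1 + ‖x‖ ^ 2)⁻¹) *
        (Real.exp (‖x‖ ^ 2 / 4) * Real.exp (-(‖x‖ ^ 2 / 4))) * (‖x‖ ^ 2)⁻¹ := by ring
    _ ≤ (8 * π)⁻¹ * (16 / 5) * 2 * 1 * (‖x‖ ^ 2)⁻¹ := by rw [hee]; gcongr
    _ = π⁻¹ * (4 / (5 * ‖x‖ ^ 2)) := by field_simp; norm_num

/-- **The weight comparison `|x|² ≤ M pχΩ`** for `λ < 1` (`a = 1 − λ > 0`). [folklore] -/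
theorem exists_normSq_le_gaussWeightChi_omega {lam : ℝ} (hlam1 : lam < 1) :
    ∃ M, 0 ≤ M ∧ ∀ x : EuclideanSpace ℝ (Fin 2), ‖x‖ ^ 2 ≤ M * ((Real.exp ((1 - lam) / 4 * ‖x‖ ^ 2) * (1 + ‖x‖ ^ 2)⁻¹) * (gaussVortexProfile x / (2 * kerWeight ‖x‖))) := by
  have ha : 0 < (1 - lam) / 4 := by linarith
  obtain ⟨C, hC0, hC⟩ := exists_one_add_pow_mul_exp_neg_le ha 6
  refine ⟨8 * π * C, by positivity, fun x => ?_⟩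
  set r := ‖x‖ with hr
  have hr0 : 0 ≤ r := norm_nonneg x
  have hΩ : (8 * π)⁻¹ * (1 / (1 + r ^ 2 / 4)) ≤ (gaussVortexProfile x / (2 * kerWeight ‖x‖)) := by
    rw [gaussVortexProfile_div_two_mul_kerWeight, ← hr]
    exact mul_le_mul_of_nonneg_left (one_div_one_add_le_burgersPhi' (by positivity)) (by positivity)
  have hpoly : r ^ 2 * (1 + r ^ 2) * (1 + r ^ 2 / 4) ≤ (1 + r) ^ 6 := by
    nlinarith [pow_pos (by linarith : (0:ℝ) < 1 + r) 2, mul_nonneg hr0 hr0, pow_nonneg hr0 3,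
      pow_nonneg hr0 4, pow_nonneg hr0 5, pow_nonneg hr0 6, sq_nonneg r]
  have hCb := hC r hr0
  have hexp1 : Real.exp (-((1 - lam) / 4 / 2 * r ^ 2)) ≤ 1 := by
    rw [Real.exp_le_one_iff]; nlinarith [sq_nonneg r]
  have hkey : r ^ 2 * (1 + r ^ 2) * (1 + r ^ 2 / 4) ≤ C * Real.exp ((1 - lam) / 4 * r ^ 2) := by
    have h1 : (1 + r) ^ 6 ≤ C * Real.exp ((1 - lam) / 4 * r ^ 2) := by
      have h2 : (1 + r) ^ 6 * Real.exp (-((1 - lam) / 4 * r ^ 2)) ≤ C * 1 :=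
        hCb.trans (mul_le_mul_of_nonneg_left hexp1 hC0.le)
      rw [Real.exp_neg, mul_inv_le_iff₀ (Real.exp_pos _)] at h2
      linarith
    exact hpoly.trans h1
  calc r ^ 2 = r ^ 2 * (1 + r ^ 2) * (1 + r ^ 2 / 4) * ((1 + r ^ 2)⁻¹ * (1 / (1 + r ^ 2 / 4))) := by
        field_simp
    _ ≤ (C * Real.exp ((1 - lam) / 4 * r ^ 2)) * ((1 + r ^ 2)⁻¹ * (1 / (1 + r ^ 2 / 4))) := by gcongr
    _ = 8 * π * C * ((Real.exp ((1 - lam) / 4 * r ^ 2) * (1 + r ^ 2)⁻¹) * ((8 * π)⁻¹ * (1 / (1 + r ^ 2 / 4)))) := by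
        field_simp
    _ ≤ 8 * π * C * ((Real.exp ((1 - lam) / 4 * r ^ 2) * (1 + r ^ 2)⁻¹) * (gaussVortexProfile x / (2 * kerWeight ‖x‖))) := by
        rw [hr]; gcongr

section Weighted

variable {w : EuclideanSpace ℝ (Fin 2) → ℝ} (hw : ContDiff ℝ 2 w) (hwc : HasCompactSupport w)
include hw hwc

omit hw in
/-- `∂_θw` has compact support. [folklore] -/
theorem hasCompactSupport_angular : HasCompactSupport fun x => fderiv ℝ w x (perp x) :=
  (hwc.fderiv (𝕜 := ℝ)).mono fun x hx h0 => hx (by simp [h0])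

end Weighted

/-- **Angular part of the vorticity from the angular part of `u = w + Φψ`** (large-circulation
form). For `0 ≤ λ < 1` there is `K` such that for all even `w ∈ C²_c` with `∫ w = 0`,

  `∫ pχΩ (∂_θw)² ≤ K ∫ pχΩ (∂_θu)²`,

`p = e^{(1−λ)|x|²/4}`, `χ = (1+|x|²)⁻¹`, `Ω = G/(2Φ)`: since `∂_θw = ∂_θu + Φ⟪v, x⟫`, this follows
from `even_sector_positivity` and the two weight comparisons above. [cite: Maekawa2009b, §4 Lemma 4.1] -/
theorem exists_integral_gaussWeightChi_omega_sq_angular_le {lam : ℝ} (hlam0 : 0 ≤ lam) (hlam1 : lam < 1) :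
    ∃ K, 0 ≤ K ∧ ∀ w : EuclideanSpace ℝ (Fin 2) → ℝ, ContDiff ℝ 2 w → HasCompactSupport w → (∀ x, w (-x) = w x) →
      ∫ x, w x = 0 →
      ∫ x, (Real.exp ((1 - lam) / 4 * ‖x‖ ^ 2) * (1 + ‖x‖ ^ 2)⁻¹) * (gaussVortexProfile x / (2 * kerWeight ‖x‖)) * (fderiv ℝ w x (perp x)) ^ 2 ≤ K * ∫ x, (Real.exp ((1 - lam) / 4 * ‖x‖ ^ 2) * (1 + ‖x‖ ^ 2)⁻¹) * (gaussVortexProfile x / (2 * kerWeight ‖x‖)) * (fderiv ℝ (fun y => w y + kerWeight ‖y‖ * ∫ z, w z * ((2 * π)⁻¹ * Real.log ‖y - z‖)) x (perp x)) ^ 2 := by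
  obtain ⟨M, hM0, hM⟩ := exists_normSq_le_gaussWeightChi_omega hlam1
  refine ⟨2 + 5 * M / (2 * π), by positivity, fun w hw hwc heven hmass => ?_⟩
  have hw1 : ContDiff ℝ 1 w := hw.of_le one_le_two
  have ha2 : 1 - lam < 2 := by linarith
  have hu1 := contDiff_one_corrected hw hwc
  have hg : Continuous fun x => ⟪biotSavart2D w x, x⟫ := (contDiff_inner_biotSavart2D_id hwc hw1).continuous
  -- the pieces
  have hpos := even_sector_positivity hw hwc heven hmass
  have iQ := integrable_gaussWeightChi_omega_mul_sq hw hwc ha2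
  have iU := integrable_normSq_mul_sq_angular_corrected hw hwc
  have iR := integrable_inv_normSq_mul_sq_inner_biotSavart2D hw hwc
  obtain ⟨iΦ, -⟩ := integrable_kerWeight_mul_sq_inner_biotSavart2D hw hwc
  have iL : Integrable fun x => (4 / ‖x‖ ^ 2 - kerWeight ‖x‖) * ⟪biotSavart2D w x, x⟫ ^ 2 := by
    have : Integrable fun x => 4 * ((‖x‖ ^ 2)⁻¹ * ⟪biotSavart2D w x, x⟫ ^ 2) - kerWeight ‖x‖ * ⟪biotSavart2D w x, x⟫ ^ 2 :=
      (iR.const_mul 4).sub iΦ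
    exact this.congr (Eventually.of_forall fun x => by beta_reduce; ring)
  have hQ0 : 0 ≤ ∫ x, (Real.exp ((1 - lam) / 4 * ‖x‖ ^ 2) * (1 + ‖x‖ ^ 2)⁻¹) * (gaussVortexProfile x / (2 * kerWeight ‖x‖)) * (fderiv ℝ (fun y => w y + kerWeight ‖y‖ * ∫ z, w z * ((2 * π)⁻¹ * Real.log ‖y - z‖)) x (perp x)) ^ 2 := integral_nonneg fun x => by
    have := (gaussVortexProfile_div_two_mul_kerWeight_le x).1
    positivity
  -- continuity of the weight
  have hWc : Continuous fun x : EuclideanSpace ℝ (Fin 2) => (Real.exp ((1 - lam) / 4 * ‖x‖ ^ 2) * (1 + ‖x‖ ^ 2)⁻¹) * (gaussVortexProfile x / (2 * kerWeight ‖x‖)) := by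
    refine (contDiff_gaussWeightChi (1 - lam)).continuous.mul ?_
    exact (contDiff_gaussVortexProfile (n := 0)).continuous.div (continuous_const.mul
      (continuous_kerWeight.comp continuous_norm)) fun x => mul_ne_zero two_ne_zero (kerWeight_pos _).ne'
  -- pointwise: `pχΩ Φ² g² ≤ (1/π) h̃ g²`
  have hpt1 : ∀ x, (Real.exp ((1 - lam) / 4 * ‖x‖ ^ 2) * (1 + ‖x‖ ^ 2)⁻¹) * (gaussVortexProfile x / (2 * kerWeight ‖x‖)) * (kerWeight ‖x‖ * ⟪biotSavart2D w x, x⟫) ^ 2 ≤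
      π⁻¹ * ((4 / ‖x‖ ^ 2 - kerWeight ‖x‖) * ⟪biotSavart2D w x, x⟫ ^ 2) := by
    intro x
    rcases eq_or_ne x 0 with hx | hx
    · subst hx; simp
    have hr : 0 < ‖x‖ := norm_pos_iff.2 hx
    have h1 := gaussWeightChi_omega_kerWeight_sq_le hlam0 hx
    have hΦ2 := kerWeight_mul_sq_le ‖x‖
    have hh : 4 / (5 * ‖x‖ ^ 2) ≤ 4 / ‖x‖ ^ 2 - kerWeight ‖x‖ := by
      rw [div_le_iff₀ (by positivity)]
      have : (4 / ‖x‖ ^ 2 - kerWeight ‖x‖) * (5 * ‖x‖ ^ 2) = 20 - 5 * (kerWeight ‖x‖ * ‖x‖ ^ 2) := by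
        field_simp
        ring
      rw [this]; linarith
    calc (Real.exp ((1 - lam) / 4 * ‖x‖ ^ 2) * (1 + ‖x‖ ^ 2)⁻¹) * (gaussVortexProfile x / (2 * kerWeight ‖x‖)) * (kerWeight ‖x‖ * ⟪biotSavart2D w x, x⟫) ^ 2
        = ((Real.exp ((1 - lam) / 4 * ‖x‖ ^ 2) * (1 + ‖x‖ ^ 2)⁻¹) * (gaussVortexProfile x / (2 * kerWeight ‖x‖)) * kerWeight ‖x‖ ^ 2) * ⟪biotSavart2D w x, x⟫ ^ 2 := by ring
      _ ≤ (π⁻¹ * (4 / (5 * ‖x‖ ^ 2))) * ⟪biotSavart2D w x, x⟫ ^ 2 := mul_le_mul_of_nonneg_right h1 (sq_nonneg _)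
      _ ≤ (π⁻¹ * (4 / ‖x‖ ^ 2 - kerWeight ‖x‖)) * ⟪biotSavart2D w x, x⟫ ^ 2 := by gcongr
      _ = _ := by ring
  -- pointwise: `(∂_θw)² ≤ 2(∂_θu)² + 2Φ²g²`
  have hpt2 : ∀ x, (Real.exp ((1 - lam) / 4 * ‖x‖ ^ 2) * (1 + ‖x‖ ^ 2)⁻¹) * (gaussVortexProfile x / (2 * kerWeight ‖x‖)) * (fderiv ℝ w x (perp x)) ^ 2 ≤
      2 * ((Real.exp ((1 - lam) / 4 * ‖x‖ ^ 2) * (1 + ‖x‖ ^ 2)⁻¹) * (gaussVortexProfile x / (2 * kerWeight ‖x‖)) * (fderiv ℝ (fun y => w y + kerWeight ‖y‖ * ∫ z, w z * ((2 * π)⁻¹ * Real.log ‖y - z‖)) x (perp x)) ^ 2) + 2 * ((Real.exp ((1 - lam) / 4 * ‖x‖ ^ 2) * (1 + ‖x‖ ^ 2)⁻¹) * (gaussVortexProfile x / (2 * kerWeight ‖x‖)) * (kerWeight ‖x‖ * ⟪biotSavart2D w x, x⟫) ^ 2) := by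
    intro x
    have hW0 : 0 ≤ (Real.exp ((1 - lam) / 4 * ‖x‖ ^ 2) * (1 + ‖x‖ ^ 2)⁻¹) * (gaussVortexProfile x / (2 * kerWeight ‖x‖)) := by
      have := (gaussVortexProfile_div_two_mul_kerWeight_le x).1; positivity
    have hθ : fderiv ℝ w x (perp x) = fderiv ℝ (fun y => w y + kerWeight ‖y‖ * ∫ z, w z * ((2 * π)⁻¹ * Real.log ‖y - z‖)) x (perp x) + kerWeight ‖x‖ * ⟪biotSavart2D w x, x⟫ := by
      rw [fderiv_corrected_perp_eq hw hwc x]; ring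
    rw [hθ]
    nlinarith [sq_nonneg (fderiv ℝ (fun y => w y + kerWeight ‖y‖ * ∫ z, w z * ((2 * π)⁻¹ * Real.log ‖y - z‖)) x (perp x) - kerWeight ‖x‖ * ⟪biotSavart2D w x, x⟫)]
  -- integrability
  have iW : Integrable fun x => (Real.exp ((1 - lam) / 4 * ‖x‖ ^ 2) * (1 + ‖x‖ ^ 2)⁻¹) * (gaussVortexProfile x / (2 * kerWeight ‖x‖)) * (fderiv ℝ w x (perp x)) ^ 2 := by
    have hθc : Continuous fun x => fderiv ℝ w x (perp x) := (contDiff_one_angular hw).continuous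
    have hs := hasCompactSupport_angular hwc
    have hcs : HasCompactSupport fun x => (Real.exp ((1 - lam) / 4 * ‖x‖ ^ 2) * (1 + ‖x‖ ^ 2)⁻¹) * (gaussVortexProfile x / (2 * kerWeight ‖x‖)) * (fderiv ℝ w x (perp x)) ^ 2 := by
      have h2 : HasCompactSupport fun x => ((Real.exp ((1 - lam) / 4 * ‖x‖ ^ 2) * (1 + ‖x‖ ^ 2)⁻¹) * (gaussVortexProfile x / (2 * kerWeight ‖x‖)) * fderiv ℝ w x (perp x)) * fderiv ℝ w x (perp x) := hs.mul_left
      have he : (fun x => (Real.exp ((1 - lam) / 4 * ‖x‖ ^ 2) * (1 + ‖x‖ ^ 2)⁻¹) * (gaussVortexProfile x / (2 * kerWeight ‖x‖)) * (fderiv ℝ w x (perp x)) ^ 2) = fun x => ((Real.exp ((1 - lam) / 4 * ‖x‖ ^ 2) * (1 + ‖x‖ ^ 2)⁻¹) * (gaussVortexProfile x / (2 * kerWeight ‖x‖)) * fderiv ℝ w x (perp x)) * fderiv ℝ w x (perp x) :=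
        funext fun x => by ring
      rw [he]; exact h2
    exact (hWc.mul (hθc.pow 2)).integrable_of_hasCompactSupport hcs
  have iG : Integrable fun x => (Real.exp ((1 - lam) / 4 * ‖x‖ ^ 2) * (1 + ‖x‖ ^ 2)⁻¹) * (gaussVortexProfile x / (2 * kerWeight ‖x‖)) * (kerWeight ‖x‖ * ⟪biotSavart2D w x, x⟫) ^ 2 := by
    refine (iL.const_mul π⁻¹).mono' (hWc.mul (((continuous_kerWeight.comp continuous_norm).mul hg).pow 2)).aestronglyMeasurable
      (Eventually.of_forall fun x => ?_)
    have hW0 : 0 ≤ (Real.exp ((1 - lam) / 4 * ‖x‖ ^ 2) * (1 + ‖x‖ ^ 2)⁻¹) * (gaussVortexProfile x / (2 * kerWeight ‖x‖)) := by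
      have := (gaussVortexProfile_div_two_mul_kerWeight_le x).1; positivity
    rw [Real.norm_of_nonneg (by positivity)]
    exact hpt1 x
  -- the chain
  have h1 : ∫ x, (Real.exp ((1 - lam) / 4 * ‖x‖ ^ 2) * (1 + ‖x‖ ^ 2)⁻¹) * (gaussVortexProfile x / (2 * kerWeight ‖x‖)) * (fderiv ℝ w x (perp x)) ^ 2 ≤
      2 * (∫ x, (Real.exp ((1 - lam) / 4 * ‖x‖ ^ 2) * (1 + ‖x‖ ^ 2)⁻¹) * (gaussVortexProfile x / (2 * kerWeight ‖x‖)) * (fderiv ℝ (fun y => w y + kerWeight ‖y‖ * ∫ z, w z * ((2 * π)⁻¹ * Real.log ‖y - z‖)) x (perp x)) ^ 2) + 2 * ∫ x, (Real.exp ((1 - lam) / 4 * ‖x‖ ^ 2) * (1 + ‖x‖ ^ 2)⁻¹) * (gaussVortexProfile x / (2 * kerWeight ‖x‖)) * (kerWeight ‖x‖ * ⟪biotSavart2D w x, x⟫) ^ 2 := by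
    rw [← integral_const_mul, ← integral_const_mul, ← integral_add (iQ.const_mul 2) (iG.const_mul 2)]
    exact integral_mono iW ((iQ.const_mul 2).add (iG.const_mul 2)) hpt2
  have h2 : ∫ x, (Real.exp ((1 - lam) / 4 * ‖x‖ ^ 2) * (1 + ‖x‖ ^ 2)⁻¹) * (gaussVortexProfile x / (2 * kerWeight ‖x‖)) * (kerWeight ‖x‖ * ⟪biotSavart2D w x, x⟫) ^ 2 ≤
      π⁻¹ * ∫ x, (4 / ‖x‖ ^ 2 - kerWeight ‖x‖) * ⟪biotSavart2D w x, x⟫ ^ 2 := by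
    rw [← integral_const_mul]
    exact integral_mono iG (iL.const_mul _) hpt1
  have h3 : ∫ x, ‖x‖ ^ 2 * (fderiv ℝ (fun y => w y + kerWeight ‖y‖ * ∫ z, w z * ((2 * π)⁻¹ * Real.log ‖y - z‖)) x (perp x)) ^ 2 ≤ M * ∫ x, (Real.exp ((1 - lam) / 4 * ‖x‖ ^ 2) * (1 + ‖x‖ ^ 2)⁻¹) * (gaussVortexProfile x / (2 * kerWeight ‖x‖)) * (fderiv ℝ (fun y => w y + kerWeight ‖y‖ * ∫ z, w z * ((2 * π)⁻¹ * Real.log ‖y - z‖)) x (perp x)) ^ 2 := by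
    rw [← integral_const_mul]
    refine integral_mono iU (iQ.const_mul M) fun x => ?_
    have := mul_le_mul_of_nonneg_right (hM x) (sq_nonneg (fderiv ℝ (fun y => w y + kerWeight ‖y‖ * ∫ z, w z * ((2 * π)⁻¹ * Real.log ‖y - z‖)) x (perp x)))
    linarith
  have hπ : 0 < π⁻¹ := by positivity
  have h4 := mul_le_mul_of_nonneg_left (hpos.trans (by nlinarith [h3] : 5 / 4 * ∫ x, ‖x‖ ^ 2 * (fderiv ℝ (fun y => w y + kerWeight ‖y‖ * ∫ z, w z * ((2 * π)⁻¹ * Real.log ‖y - z‖)) x (perp x)) ^ 2 ≤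
    5 / 4 * (M * ∫ x, (Real.exp ((1 - lam) / 4 * ‖x‖ ^ 2) * (1 + ‖x‖ ^ 2)⁻¹) * (gaussVortexProfile x / (2 * kerWeight ‖x‖)) * (fderiv ℝ (fun y => w y + kerWeight ‖y‖ * ∫ z, w z * ((2 * π)⁻¹ * Real.log ‖y - z‖)) x (perp x)) ^ 2))) hπ.le
  have e5 : (2 + 5 * M / (2 * π)) * ∫ x, (Real.exp ((1 - lam) / 4 * ‖x‖ ^ 2) * (1 + ‖x‖ ^ 2)⁻¹) * (gaussVortexProfile x / (2 * kerWeight ‖x‖)) * (fderiv ℝ (fun y => w y + kerWeight ‖y‖ * ∫ z, w z * ((2 * π)⁻¹ * Real.log ‖y - z‖)) x (perp x)) ^ 2 =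
      2 * (∫ x, (Real.exp ((1 - lam) / 4 * ‖x‖ ^ 2) * (1 + ‖x‖ ^ 2)⁻¹) * (gaussVortexProfile x / (2 * kerWeight ‖x‖)) * (fderiv ℝ (fun y => w y + kerWeight ‖y‖ * ∫ z, w z * ((2 * π)⁻¹ * Real.log ‖y - z‖)) x (perp x)) ^ 2) + 2 * (π⁻¹ * (5 / 4 * (M * ∫ x, (Real.exp ((1 - lam) / 4 * ‖x‖ ^ 2) * (1 + ‖x‖ ^ 2)⁻¹) * (gaussVortexProfile x / (2 * kerWeight ‖x‖)) * (fderiv ℝ (fun y => w y + kerWeight ‖y‖ * ∫ z, w z * ((2 * π)⁻¹ * Real.log ‖y - z‖)) x (perp x)) ^ 2))) := by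
    field_simp
    ring
  rw [e5]
  linarith [h1, h2, h4]

end Literature.Analysis.FluidPDE
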